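import Literature.NumberTheory.Sieve.SmoothMajorantAssembly
import Literature.NumberTheory.Sieve.SmoothMajorantZetaBounds
import Literature.NumberTheory.Sieve.SmoothMajorantZetaRatio
import Literature.NumberTheory.Sieve.SmoothMajorantCChi
import Mathlib.Analysis.SpecialFunctions.Log.Summable
import Mathlib.NumberTheory.Primorial
import HarnessLib

/-!
# The smooth linear forms estimate (Conlon–Fox–Zhao Prop. 8.3): main-term and error bookkeeping

Trunk T-SIEVE. D. Conlon, J. Fox, Y. Zhao, *The Green–Tao theorem: an exposition*
(arXiv:1403.2957 = EMS Surv. Math. Sci. 1 (2014)), §9, "Verifying the linear forms condition",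
displays (28)–(38) and the paragraph "Error estimates". Continuation of `SmoothMajorantAssembly`
(which expands `E_{x∈B} ∏_j Λ_{χ,R}(θ_j(x))²` into the tuple sum (28)/(29) and passes to the local
densities); everything in this file is proved. Equation numbers are the printed global display
numbers of §9 (earlier files of this series wrote "(9.n)" for display (27+n)).

## Contents

* `sum_piFinset_eq_of_vanish`: re-indexing the tuple sum from `[1,R]^{2m}` to the square-free
  tuples with prime factors below `Q > R` (the extra/missing terms vanish).
* `prod_absLocalFactor_le`: `∏_{p<Q} E⁺_p(s) ≤ (1/s + C)^{3m} e^{2·4^m}`, the absolute bound behind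
  the "Estimate (32)" paragraph (`ζ(1 + 1/log R)^{O(1)} = O(log^{O(1)} R)`); it is the dominator
  for all limit interchanges below.
* The printed route through the truncated Fourier integral (30)–(32): `truncFourier`,
  `exists_truncFourier_bounds` ((30) with its `O_A(d^{-1/log R} T^{-A})` error),
  `exists_norm_prod_chi_sub_prod_truncFourier_le` ((31)), `sum_coef_prod_truncFourier_eq_integral`
  ((32) = (33) on the box `I^{2m}`, `boxMeasure`), `tendsto_integral_prod_eulerFactor`.
* The route actually used downstream (`section Untruncated`): since
  `χ(log d/log R) = ∫_ℝ φ(η) d^{-z(η)} dη` holds exactly (`chi_eq_integral`) and the tuple sum is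
  finite, the expanded sum equals `∫_{ℝ^{2m}} (∏_v φ(η_v)) ∏_{p∈P} E_p(z(η)) dη` exactly
  (`sum_coef_prod_chi_eq_integral`), and `Q → ∞` is a dominated convergence on the whole space
  (`tendsto_integral_prod_eulerFactor_full`); no truncation error arises.
* (34): `E_p = E'_p (1 + O_m(p^{-2}))` for `p > w` (`norm_eulerFactor_div_sub_one_le`, with the
  explicit constant `deltaConst m`, non-degeneracy mod `p` from `|L_{ij}| ≤ C`, `p > 2C²`:
  `nondegenerate_mod_of_bounds`), the decomposition `∏_{p<Q} E_p = (∏_{p<Q} E'_p/∏_{p≤w} E'_p) ∏(1+δ'_q)`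
  (`prod_eulerFactor_eq_of_lt`), `∑ |δ'_q| ≤ deltaConst/w` and `|∏(1+δ') - 1| ≤ e^{D/w} - 1`
  (`norm_tprod_sub_one_le_of_sq_decay`), and the limit
  `∏_{p<Q} E_p → ζ-ratio / ∏_{p≤w} E'_p · ∏'(1+δ')` (`tendsto_prod_eulerFactor`, via (35)).
* (35)–(36) pointwise on the box `|η_v| ≤ T` (`norm_limit_sub_main_le`): the limit equals
  `mainZ(η) (W/φ(W))^m` up to the relative error `(1+α)(1+2β)(1+γ) - 1`
  (`α`: zeta ratio vs `z z'/(z+z')`, `β`: `∏_{p≤w} E'_p` vs `(φ(W)/W)^m` (`totient_primorial_div`),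
  `γ`: the correction product), with `mainZ = ∏_j z_j z'_j/(z_j+z'_j)`; `norm_mainZ_le`.
* (37)–(38): `∫_{ℝ^{2m}} (∏_v φ(η_v)) mainZ(η) dη = (c_χ/log R)^m` exactly (`integral_phiF_mainZ`:
  regrouping `ℝ^{[m]⊔[m]} ≃ ℝ^m × ℝ^m`, Fubini, and the double integral (38) from
  `SmoothMajorantCChi.integral_integral_phiF_kernel`).

The final ε-bookkeeping (choice of `T = log^{1/2} R`, of the growth bound for `w`, and the tails of
`φ` off the box) and the discharge of `SmoothLinearFormsEstimate` are in `SmoothMajorantFinal`.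

## References
* D. Conlon, J. Fox, Y. Zhao, EMS Surv. Math. Sci. 1 (2014), 249–282, §9. [cite: ConlonFoxZhao2014]
-/
noncomputable section

open Finset
open scoped BigOperators

namespace Literature.NumberTheory.Sieve.CFZ

variable {m t : ℕ}

/-! ### Re-indexing the tuple sum -/

/-- Two boxes of tuples carry the same sum of a function vanishing off the common part: if
`f(dd) = 0` unless every entry lies in `S₁ ∩ S₂`, then `∑_{S₁^ι} f = ∑_{S₂^ι} f`. Used with
`S₁ = [1, R]`, `S₂ =` square-free numbers with prime factors `< Q` (`Q > R`): the coefficient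
`∏_v μ(dd_v) χ(log dd_v/log R)` vanishes unless all `dd_v` are square-free and `≤ R`. [folklore] -/
theorem sum_piFinset_eq_of_vanish {ι : Type*} [Fintype ι] [DecidableEq ι] {R' : Type*} [AddCommMonoid R']
    (S₁ S₂ : Finset ℕ) (f : (ι → ℕ) → R') (hf : ∀ dd : ι → ℕ, (∃ v, dd v ∉ S₁ ∩ S₂) → f dd = 0) :
    ∑ dd ∈ Fintype.piFinset (fun _ : ι => S₁), f dd = ∑ dd ∈ Fintype.piFinset (fun _ : ι => S₂), f dd := by
  have key : ∀ S : Finset ℕ, S₁ ∩ S₂ ⊆ S →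
      ∑ dd ∈ Fintype.piFinset (fun _ : ι => S), f dd = ∑ dd ∈ Fintype.piFinset (fun _ : ι => S₁ ∩ S₂), f dd := by
    intro S hS
    symm
    refine sum_subset (Fintype.piFinset_subset _ _ fun _ => hS) fun dd hdd hdd' => hf dd ?_
    by_contra h
    push Not at h
    exact hdd' (Fintype.mem_piFinset.2 h)
  rw [key S₁ inter_subset_left, key S₂ inter_subset_right]

/-! ### The absolute local factors -/

/-- `1 + 3m p^{-1-s} + 4^m/p² ≤ (1 + 3m p^{-(1+s)})(1 + 4^m/p²)`. [folklore] -/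
theorem one_add_add_le_mul (x y : ℝ) (hx : 0 ≤ x) (hy : 0 ≤ y) : 1 + x + y ≤ (1 + x) * (1 + y) := by
  nlinarith

/-- **The bound behind the "Estimate (32)" paragraph**: over the primes `p < Q`, with `E⁺_p(s) = 1` for `p ∣ W` and
`E⁺_p(s) ≤ 1 + 3m p^{-1-s} + 4^m p^{-2}` otherwise,
`∏_{p<Q} E⁺_p(s) ≤ (1/s + C)^{3m} exp(2·4^m)` for `0 < s ≤ 1` ("`ζ(1 + 1/log R) = O(log R)`").
[cite: ConlonFoxZhao2014, Section 9, Error estimates, Estimate (32)] -/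
theorem prod_absLocalFactor_le : ∃ C : ℝ, 0 ≤ C ∧ ∀ (m : ℕ) (Q : ℕ) (E : ℕ → ℝ) (s : ℝ), 0 < s → s ≤ 1 →
    (∀ p ∈ Q.primesBelow, 0 ≤ E p) →
    (∀ p ∈ Q.primesBelow, E p ≤ 1 + 3 * m * (p : ℝ) ^ (-(1 + s)) + 4 ^ m / (p : ℝ) ^ 2) →
    ∏ p ∈ Q.primesBelow, E p ≤ (1 / s + C) ^ (3 * m) * Real.exp (2 * 4 ^ m) := by
  obtain ⟨C, hC0, hC⟩ := exists_prod_one_add_mul_rpow_le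
  refine ⟨C, hC0, fun m Q E s hs0 hs1 hE0 hE => ?_⟩
  have h1 : ∏ p ∈ Q.primesBelow, E p ≤
      ∏ p ∈ Q.primesBelow, ((1 + (3 * m : ℕ) * (p : ℝ) ^ (-(1 + s))) * (1 + 4 ^ m / (p : ℝ) ^ 2)) := by
    refine prod_le_prod hE0 fun p hp => (hE p hp).trans ?_
    push_cast
    exact one_add_add_le_mul _ _ (by positivity) (by positivity)
  refine h1.trans ?_
  rw [prod_mul_distrib]
  have hσ1 : 1 < 1 + s := by linarith
  have hσ2 : 1 + s ≤ 2 := by linarith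
  have h2 := hC (3 * m) (1 + s) hσ1 hσ2 Q
  rw [show (1 + s - 1 : ℝ) = s by ring] at h2
  have h3 := prod_primesBelow_one_add_div_sq_le (K := (4 : ℝ) ^ m) (by positivity) Q
  exact mul_le_mul h2 h3 (prod_nonneg fun p _ => by positivity) (by positivity)

/-! ### S7 step (iv): the Fourier substitution (CFZ (30) → (31)) -/

section Fourier

open MeasureTheory Complex

variable {χ : ℝ → ℝ} (hs : ContDiff ℝ (⊤ : ℕ∞) χ) (hsupp : ∀ x, 1 ≤ |x| → χ x = 0)
  (hχ1 : ∀ x, |χ x| ≤ 1)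

/-- The truncated Fourier integral `J_T(d) = ∫_{[-T,T]} φ(η) d^{-z(η)} dη`.
[cite: ConlonFoxZhao2014, Section 9, equation (30)] -/
def truncFourier (χ : ℝ → ℝ) (R T : ℝ) (d : ℕ) : ℂ :=
  ∫ η in Set.Icc (-T) T, phiF χ η * (d : ℂ) ^ (-(zOf R η))

/-- `(x+y)^n - x^n ≤ n y (x+y)^{n-1}` for `x, y ≥ 0`. [folklore] -/
theorem add_pow_sub_pow_le (x y : ℝ) (hx : 0 ≤ x) (hy : 0 ≤ y) (n : ℕ) :
    (x + y) ^ n - x ^ n ≤ n * y * (x + y) ^ (n - 1) := by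
  have h := geom_sum₂_mul (x + y) x n
  rw [add_sub_cancel_left] at h
  rw [← h]
  have hterm : ∀ i ∈ range n, (x + y) ^ i * x ^ (n - 1 - i) ≤ (x + y) ^ (n - 1) := by
    intro i hi
    rw [mem_range] at hi
    calc (x + y) ^ i * x ^ (n - 1 - i) ≤ (x + y) ^ i * (x + y) ^ (n - 1 - i) := by
          gcongr; linarith
      _ = (x + y) ^ (n - 1) := by rw [← pow_add]; congr 1; omega
  calc (∑ i ∈ range n, (x + y) ^ i * x ^ (n - 1 - i)) * y ≤ (∑ _i ∈ range n, (x + y) ^ (n - 1)) * y := by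
        gcongr with i hi; exact hterm i hi
    _ = n * y * (x + y) ^ (n - 1) := by rw [sum_const, card_range, nsmul_eq_mul]; ring

include hsupp hχ1 in
/-- `|χ(log d/log R)| ≤ e · d^{-1/log R}` for `d ≥ 1`, `R > 1` ("`χ(log d/log R) = O(d^{-1/log R})`;
we only need to check this for `d ≤ R` since `χ` is supported on `[-1,1]`").
[cite: ConlonFoxZhao2014, Section 9] -/
theorem abs_chi_le_exp_mul_rpow {R : ℝ} (hR : 1 < R) {d : ℕ} (hd : 1 ≤ d) :
    |χ (Real.log d / Real.log R)| ≤ Real.exp 1 * (d : ℝ) ^ (-(1 / Real.log R)) := by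
  have hlogR : 0 < Real.log R := Real.log_pos hR
  have hd0 : (0 : ℝ) < d := by exact_mod_cast hd
  by_cases hdR : (d : ℝ) ≤ R
  · -- `d ≤ R`: `d^{-1/log R} ≥ e^{-1}`
    have h1 : Real.exp (-1) ≤ (d : ℝ) ^ (-(1 / Real.log R)) := by
      rw [Real.rpow_def_of_pos hd0, Real.exp_le_exp]
      have hlogd : Real.log d ≤ Real.log R := Real.log_le_log hd0 hdR
      have : Real.log d * (1 / Real.log R) ≤ 1 := by
        rw [mul_one_div, div_le_one hlogR]; exact hlogd
      linarith
    calc |χ (Real.log d / Real.log R)| ≤ 1 := hχ1 _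
      _ = Real.exp 1 * Real.exp (-1) := by rw [← Real.exp_add]; simp
      _ ≤ Real.exp 1 * (d : ℝ) ^ (-(1 / Real.log R)) := by gcongr
  · -- `d > R`: `χ = 0`
    have hx : 1 ≤ |Real.log d / Real.log R| := by
      rw [abs_of_nonneg (div_nonneg (Real.log_nonneg (by exact_mod_cast hd)) hlogR.le),
        le_div_iff₀ hlogR, one_mul]
      exact Real.log_le_log (by linarith) (le_of_lt (not_le.1 hdR))
    rw [hsupp _ hx, abs_zero]
    positivity

include hs hsupp hχ1 in
/-- **Truncated Fourier representation with error** (CFZ (30)): for every `A` there is `C_A` with,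
for `T ≥ 1`, `R > 1`, `d ≥ 1`, `s = 1/log R`:
`‖χ(log d/log R) - J_T(d)‖ ≤ C_A d^{-s} T^{-A}` and `‖J_T(d)‖ ≤ (e + C_A) d^{-s}`.
[cite: ConlonFoxZhao2014, Section 9, equation (30)] -/
theorem exists_truncFourier_bounds (A : ℕ) : ∃ C : ℝ, 0 ≤ C ∧ ∀ T : ℝ, 1 ≤ T → ∀ R : ℝ, 1 < R →
    ∀ d : ℕ, 1 ≤ d →
      ‖((χ (Real.log d / Real.log R) : ℝ) : ℂ) - truncFourier χ R T d‖ ≤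
          C * (d : ℝ) ^ (-(1 / Real.log R)) * (T ^ A)⁻¹ ∧
        ‖truncFourier χ R T d‖ ≤ (Real.exp 1 + C) * (d : ℝ) ^ (-(1 / Real.log R)) := by
  obtain ⟨C, hC0, hC⟩ := norm_integral_sub_setIntegral_phiF_le hs hsupp A
  refine ⟨C, hC0, fun T hT R hR d hd => ?_⟩
  have h1 : ‖((χ (Real.log d / Real.log R) : ℝ) : ℂ) - truncFourier χ R T d‖ ≤
      C * (d : ℝ) ^ (-(1 / Real.log R)) * (T ^ A)⁻¹ := by
    rw [chi_eq_integral hs hsupp hR hd]; exact hC T hT R d hd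
  refine ⟨h1, ?_⟩
  have hTA : (T ^ A)⁻¹ ≤ 1 := inv_le_one_of_one_le₀ (one_le_pow₀ hT)
  have hds : 0 ≤ (d : ℝ) ^ (-(1 / Real.log R)) := by positivity
  calc ‖truncFourier χ R T d‖
      = ‖((χ (Real.log d / Real.log R) : ℝ) : ℂ) - (((χ (Real.log d / Real.log R) : ℝ) : ℂ) - truncFourier χ R T d)‖ := by
        rw [sub_sub_cancel]
    _ ≤ ‖((χ (Real.log d / Real.log R) : ℝ) : ℂ)‖ + ‖((χ (Real.log d / Real.log R) : ℝ) : ℂ) - truncFourier χ R T d‖ :=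
        norm_sub_le _ _
    _ ≤ Real.exp 1 * (d : ℝ) ^ (-(1 / Real.log R)) + C * (d : ℝ) ^ (-(1 / Real.log R)) * 1 := by
        refine add_le_add ?_ (h1.trans (by gcongr))
        rw [Complex.norm_real, Real.norm_eq_abs]; exact abs_chi_le_exp_mul_rpow hsupp hχ1 hR hd
    _ = (Real.exp 1 + C) * (d : ℝ) ^ (-(1 / Real.log R)) := by ring

include hs hsupp hχ1 in
/-- **The product over the slots** (CFZ (31)): for a tuple `dd` of positive integers,
`‖∏_v χ(log dd_v/log R) - ∏_v J_T(dd_v)‖ ≤ n C_A T^{-A} (e + 2C_A)^{n-1} ∏_v dd_v^{-s}`, `n = #slots`.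
[cite: ConlonFoxZhao2014, Section 9] -/
theorem exists_norm_prod_chi_sub_prod_truncFourier_le (A : ℕ) : ∃ C : ℝ, 0 ≤ C ∧
    ∀ {ι : Type} [Fintype ι] [DecidableEq ι], ∀ T : ℝ, 1 ≤ T → ∀ R : ℝ, 1 < R →
    ∀ dd : ι → ℕ, (∀ v, 1 ≤ dd v) →
      ‖(∏ v, ((χ (Real.log (dd v) / Real.log R) : ℝ) : ℂ)) - ∏ v, truncFourier χ R T (dd v)‖ ≤
        (Fintype.card ι) * (C * (T ^ A)⁻¹) * (Real.exp 1 + 2 * C) ^ (Fintype.card ι - 1) *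
          ∏ v, (dd v : ℝ) ^ (-(1 / Real.log R)) := by
  obtain ⟨C, hC0, hC⟩ := exists_truncFourier_bounds hs hsupp hχ1 A
  refine ⟨C, hC0, fun {ι} _ _ T hT R hR dd hdd => ?_⟩
  set s : ℝ := 1 / Real.log R
  have hTA : (T ^ A)⁻¹ ≤ 1 := inv_le_one_of_one_le₀ (one_le_pow₀ hT)
  -- `a_v = J_v`, `b_v = χ_v - J_v`
  have h := norm_prod_add_sub_prod_le (univ : Finset ι) (fun v => truncFourier χ R T (dd v))
    (fun v => ((χ (Real.log (dd v) / Real.log R) : ℝ) : ℂ) - truncFourier χ R T (dd v))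
    (X := fun v => (Real.exp 1 + C) * (dd v : ℝ) ^ (-s))
    (Y := fun v => C * (T ^ A)⁻¹ * (dd v : ℝ) ^ (-s))
    (fun v _ => (hC T hT R hR (dd v) (hdd v)).2)
    (fun v _ => by have := (hC T hT R hR (dd v) (hdd v)).1; linarith [this, le_refl (0:ℝ)] )
  simp only [add_sub_cancel] at h
  refine h.trans ?_
  -- homogeneity in `∏ dd_v^{-s}`
  have hP0 : 0 ≤ ∏ v, (dd v : ℝ) ^ (-s) := prod_nonneg fun v _ => by positivity
  rw [show (fun v => (Real.exp 1 + C) * (dd v : ℝ) ^ (-s) + C * (T ^ A)⁻¹ * (dd v : ℝ) ^ (-s)) =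
      fun v => ((Real.exp 1 + C) + C * (T ^ A)⁻¹) * (dd v : ℝ) ^ (-s) from funext fun v => by ring,
    prod_mul_distrib, prod_mul_distrib, prod_const, prod_const, card_univ, ← sub_mul]
  refine mul_le_mul_of_nonneg_right ?_ hP0
  have hx : 0 ≤ Real.exp 1 + C := by positivity
  have hy : 0 ≤ C * (T ^ A)⁻¹ := by positivity
  refine (add_pow_sub_pow_le _ _ hx hy _).trans ?_
  have : Real.exp 1 + C + C * (T ^ A)⁻¹ ≤ Real.exp 1 + 2 * C := by nlinarith
  gcongr

end Fourier

/-! ### S7 step (v): swapping the finite sum and the integrals (CFZ (32)–(33)) -/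

section Swap

open MeasureTheory Complex

/-- The truncation box measure on `[m] ⊔ [m] → ℝ`: the product of Lebesgue measure restricted to
`[-T, T]` (a finite measure). [cite: ConlonFoxZhao2014, Section 9] -/
def boxMeasure (m : ℕ) (T : ℝ) : Measure (Fin m ⊕ Fin m → ℝ) :=
  Measure.pi fun _ => (volume : Measure ℝ).restrict (Set.Icc (-T) T)

/-- The box measure is finite. [cite: ConlonFoxZhao2014, Section 9] -/
instance boxMeasure_isFiniteMeasure (m : ℕ) (T : ℝ) : IsFiniteMeasure (boxMeasure m T) := by
  unfold boxMeasure; infer_instance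

/-- The exponents `(z(η_v))_v` split into the two halves. [cite: ConlonFoxZhao2014, Section 9] -/
theorem sumExp_zOf (R : ℝ) (η : Fin m ⊕ Fin m → ℝ) (v : Fin m ⊕ Fin m) :
    sumExp (fun j => zOf R (η (Sum.inl j))) (fun j => zOf R (η (Sum.inr j))) v = zOf R (η v) := by
  rcases v with j | j <;> rfl

/-- **`∏_v J_T(dd_v) = ∫_{[-T,T]^{2m}} ∏_v φ(η_v) dd_v^{-z(η_v)} dη`** (product of integrals).
[cite: ConlonFoxZhao2014, Section 9] -/
theorem prod_truncFourier_eq_integral (χ : ℝ → ℝ) (R T : ℝ) (dd : Fin m ⊕ Fin m → ℕ) :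
    ∏ v, truncFourier χ R T (dd v) =
      ∫ η, ∏ v, phiF χ (η v) * ((dd v : ℕ) : ℂ) ^ (-(zOf R (η v))) ∂(boxMeasure m T) := by
  unfold boxMeasure truncFourier
  rw [integral_fintype_prod_eq_prod (f := fun v x => phiF χ x * ((dd v : ℕ) : ℂ) ^ (-(zOf R x)))]

/-- `z(η)` is continuous. [cite: ConlonFoxZhao2014, Section 9] -/
theorem continuous_zOf (R : ℝ) : Continuous (zOf R) := by
  unfold zOf; fun_prop

/-- The summands of (32) are integrable on the box (bounded by `‖c‖ C₀^{2m}`, continuous), `R > 1`.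
[cite: ConlonFoxZhao2014, Section 9] -/
theorem integrable_coef_prod {χ : ℝ → ℝ} (hs : ContDiff ℝ (⊤ : ℕ∞) χ) (hsupp : ∀ x, 1 ≤ |x| → χ x = 0)
    {R : ℝ} (hR : 1 < R) (T : ℝ) (dd : Fin m ⊕ Fin m → ℕ) (hdd : ∀ v, 1 ≤ dd v) (c : ℂ) :
    Integrable (fun η : Fin m ⊕ Fin m → ℝ =>
      c * ∏ v, ((ArithmeticFunction.moebius (dd v) : ℂ) * (phiF χ (η v) * ((dd v : ℕ) : ℂ) ^ (-(zOf R (η v))))))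
      (boxMeasure m T) := by
  obtain ⟨C₀, hC₀, hφ⟩ := norm_phiF_le hs hsupp 0
  have hφc : Continuous (phiF χ) := by rw [← phiS_coe hs hsupp]; exact (phiS hs hsupp).continuous
  have hlogR : 0 < Real.log R := Real.log_pos hR
  -- continuity
  have hcont : Continuous fun η : Fin m ⊕ Fin m → ℝ =>
      c * ∏ v, ((ArithmeticFunction.moebius (dd v) : ℂ) * (phiF χ (η v) * ((dd v : ℕ) : ℂ) ^ (-(zOf R (η v))))) := by
    refine continuous_const.mul (continuous_finsetProd _ fun v _ => continuous_const.mul ?_)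
    refine (hφc.comp (continuous_apply v)).mul ?_
    have hd0 : ((dd v : ℕ) : ℂ) ≠ 0 := by exact_mod_cast (by have := hdd v; omega : dd v ≠ 0)
    exact Continuous.const_cpow (((continuous_zOf R).comp (continuous_apply v)).neg) (Or.inl hd0)
  -- bound
  have hbound : ∀ η : Fin m ⊕ Fin m → ℝ,
      ‖c * ∏ v, ((ArithmeticFunction.moebius (dd v) : ℂ) * (phiF χ (η v) * ((dd v : ℕ) : ℂ) ^ (-(zOf R (η v)))))‖ ≤
        ‖c‖ * C₀ ^ (Fintype.card (Fin m ⊕ Fin m)) := by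
    intro η
    rw [norm_mul, norm_prod]
    refine mul_le_mul_of_nonneg_left ?_ (norm_nonneg _)
    calc ∏ v, ‖(ArithmeticFunction.moebius (dd v) : ℂ) * (phiF χ (η v) * ((dd v : ℕ) : ℂ) ^ (-(zOf R (η v))))‖
        ≤ ∏ _v : Fin m ⊕ Fin m, C₀ := by
          refine prod_le_prod (fun v _ => norm_nonneg _) fun v _ => ?_
          rw [norm_mul, norm_mul, norm_natCast_cpow_neg_zOf R (hdd v)]
          have hμ : ‖(ArithmeticFunction.moebius (dd v) : ℂ)‖ ≤ 1 := by
            rw [Complex.norm_intCast]; exact_mod_cast ArithmeticFunction.abs_moebius_le_one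
          have hds : (dd v : ℝ) ^ (-(1 / Real.log R)) ≤ 1 :=
            Real.rpow_le_one_of_one_le_of_nonpos (by exact_mod_cast hdd v)
              (by rw [neg_nonpos]; positivity)
          have h1 := hφ (η v)
          simp only [pow_zero, inv_one, mul_one] at h1
          calc ‖(ArithmeticFunction.moebius (dd v) : ℂ)‖ * (‖phiF χ (η v)‖ * (dd v : ℝ) ^ (-(1 / Real.log R)))
              ≤ 1 * (C₀ * 1) := by gcongr
            _ = C₀ := by ring
      _ = C₀ ^ (Fintype.card (Fin m ⊕ Fin m)) := by rw [prod_const, card_univ]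
  exact (integrable_const (‖c‖ * C₀ ^ (Fintype.card (Fin m ⊕ Fin m)))).mono' hcont.aestronglyMeasurable
    (Filter.Eventually.of_forall hbound)

/-- **CFZ (32) = (33)**: the main sum with truncated integrals equals the integral over the box of
`(∏_v φ(η_v)) · ∏_{p ∈ P} E_p(z(η))` (swap the finite sum and the integral, then
`tupleSum_eq_prod_eulerFactor`), given integrability of each summand (they are bounded and
continuous on a finite measure; supplied by the caller). [cite: ConlonFoxZhao2014, Section 9, equations (32)–(33)] -/
theorem sum_coef_prod_truncFourier_eq_integral (χ : ℝ → ℝ) (R T : ℝ) {P : Finset ℕ}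
    (hP : ∀ p ∈ P, p.Prime) (W : ℕ) (L : Fin m → Fin t → ℤ) (b : Fin m → ℤ)
    (hint : ∀ dd ∈ Fintype.piFinset (fun _ : Fin m ⊕ Fin m => squarefreeOf P),
      Integrable (fun η : Fin m ⊕ Fin m → ℝ =>
        (tupleDensity W L b (fun j => dd (Sum.inl j)) (fun j => dd (Sum.inr j)) : ℂ) *
          ∏ v, ((ArithmeticFunction.moebius (dd v) : ℂ) * (phiF χ (η v) * ((dd v : ℕ) : ℂ) ^ (-(zOf R (η v))))))
        (boxMeasure m T)) :
    ∑ dd ∈ Fintype.piFinset (fun _ : Fin m ⊕ Fin m => squarefreeOf P),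
        (tupleDensity W L b (fun j => dd (Sum.inl j)) (fun j => dd (Sum.inr j)) : ℂ) *
          ((∏ v, (ArithmeticFunction.moebius (dd v) : ℂ)) * ∏ v, truncFourier χ R T (dd v)) =
      ∫ η, (∏ v, phiF χ (η v)) *
        ∏ p ∈ P, eulerFactor p W L b (fun j => zOf R (η (Sum.inl j))) (fun j => zOf R (η (Sum.inr j)))
        ∂(boxMeasure m T) := by
  -- each summand as an integral
  have hterm : ∀ dd ∈ Fintype.piFinset (fun _ : Fin m ⊕ Fin m => squarefreeOf P),
      (tupleDensity W L b (fun j => dd (Sum.inl j)) (fun j => dd (Sum.inr j)) : ℂ) *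
          ((∏ v, (ArithmeticFunction.moebius (dd v) : ℂ)) * ∏ v, truncFourier χ R T (dd v)) =
        ∫ η, (tupleDensity W L b (fun j => dd (Sum.inl j)) (fun j => dd (Sum.inr j)) : ℂ) *
          ∏ v, ((ArithmeticFunction.moebius (dd v) : ℂ) * (phiF χ (η v) * ((dd v : ℕ) : ℂ) ^ (-(zOf R (η v)))))
          ∂(boxMeasure m T) := by
    intro dd _
    rw [prod_truncFourier_eq_integral, ← integral_const_mul, ← integral_const_mul]
    refine integral_congr_ae (Filter.Eventually.of_forall fun η => ?_)
    simp only [prod_mul_distrib]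
  rw [sum_congr rfl hterm, ← integral_finsetSum _ hint]
  refine integral_congr_ae (Filter.Eventually.of_forall fun η => ?_)
  -- pointwise: the integrand is `(∏ φ) · tupleSum = (∏ φ) · ∏ E_p`
  show ∑ dd ∈ Fintype.piFinset (fun _ : Fin m ⊕ Fin m => squarefreeOf P),
      (tupleDensity W L b (fun j => dd (Sum.inl j)) (fun j => dd (Sum.inr j)) : ℂ) *
        ∏ v, ((ArithmeticFunction.moebius (dd v) : ℂ) * (phiF χ (η v) * ((dd v : ℕ) : ℂ) ^ (-(zOf R (η v))))) =
    (∏ v, phiF χ (η v)) *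
      ∏ p ∈ P, eulerFactor p W L b (fun j => zOf R (η (Sum.inl j))) (fun j => zOf R (η (Sum.inr j)))
  rw [← tupleSum_eq_prod_eulerFactor hP]
  unfold tupleSum
  rw [mul_sum]
  refine sum_congr rfl fun dd _ => ?_
  simp only [sumExp_zOf, prod_mul_distrib]
  ring

end Swap

/-! ### S7 step (vi), pointwise: `E_p = E'_p (1 + O_m(p^{-2}))` for `p > w` -/

section Pointwise

/-- **Non-degeneracy modulo large primes from integer data**: if `|L_{ij}| ≤ C`, the rows are
nonzero and pairwise non-proportional over `ℚ`, and `p > 2C²` is prime, then modulo `p` every row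
is nonzero and every pair of rows has a nonzero `2 × 2` minor ("no two `ψ_i` multiples of each
other modulo `p`", valid for `p > w` once `w` is large). [cite: ConlonFoxZhao2014, Section 9] -/
theorem nondegenerate_mod_of_bounds {p : ℕ} [Fact p.Prime] {C : ℕ} (hpC : 2 * C ^ 2 < p)
    (L : Fin m → Fin t → ℤ) (hC : ∀ i j, |L i j| ≤ C) (hL0 : ∀ i, L i ≠ 0)
    (hLp : ∀ i i', i ≠ i' → ∀ c : ℚ, (fun j => (L i j : ℚ)) ≠ c • fun j => (L i' j : ℚ)) :
    (∀ i, ∃ j, (L i j : ZMod p) ≠ 0) ∧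
      (∀ i i', i ≠ i' → ∃ j₀ j₁ : Fin t, j₀ ≠ j₁ ∧
        ((L i j₀ * L i' j₁ - L i j₁ * L i' j₀ : ℤ) : ZMod p) ≠ 0) := by
  have hp : p.Prime := Fact.out
  constructor
  · intro i
    obtain ⟨j, hj⟩ : ∃ j, L i j ≠ 0 := by
      by_contra h
      push Not at h
      exact hL0 i (funext h)
    refine ⟨j, fun h0 => hj ?_⟩
    rw [ZMod.intCast_zmod_eq_zero_iff_dvd] at h0
    have hlt : |L i j| < p := by
      calc |L i j| ≤ C := hC i j
        _ ≤ 2 * (C : ℤ) ^ 2 := by nlinarith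
        _ < p := by exact_mod_cast hpC
    exact Int.eq_zero_of_abs_lt_dvd h0 hlt
  · intro i i' hii'
    obtain ⟨j₀, j₁, hj, hM, hMB⟩ := exists_minor_ne_zero (L i) (L i') (hL0 i') (hLp i i' hii')
      (B := C) (hC i) (hC i')
    exact ⟨j₀, j₁, hj, by exact_mod_cast intCast_minor_ne_zero hM hMB hpC⟩

/-- The constant in `E_p/E'_p - 1 = O(p^{-2})`. [cite: ConlonFoxZhao2014, Section 9] -/
def deltaConst (m : ℕ) : ℝ := 2 * (4 ^ m + (49 * (m : ℝ) ^ 2 * (9 / 2) ^ m + 8 * m))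

/-- `0 ≤ deltaConst m`. [cite: ConlonFoxZhao2014, Section 9] -/
theorem deltaConst_nonneg (m : ℕ) : 0 ≤ deltaConst m := by unfold deltaConst; positivity

/-- **`E_p = E'_p (1 + δ_p)`, `|δ_p| ≤ deltaConst(m)/p²`** for `p ∤ W`, `p ≥ 21m + 2`, the system
non-degenerate modulo `p`, `Re z, Re z' ≥ 0` ("`E_p(ξ) = (1 + O(p^{-2})) E'_p(ξ)`").
[cite: ConlonFoxZhao2014, Section 9] -/
theorem norm_eulerFactor_div_sub_one_le {p W n : ℕ} [Fact p.Prime] (hpW : ¬ p ∣ W) (hp : 21 * m + 2 ≤ p)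
    (L : Fin m → Fin (n + 1) → ℤ) (b : Fin m → ℤ)
    (hrow : ∀ i, ∃ j, (L i j : ZMod p) ≠ 0)
    (hmin : ∀ i i', i ≠ i' → ∃ j₀ j₁ : Fin (n + 1), j₀ ≠ j₁ ∧
      ((L i j₀ * L i' j₁ - L i j₁ * L i' j₀ : ℤ) : ZMod p) ≠ 0)
    {z z' : Fin m → ℂ} (hz : ∀ j, 0 ≤ (z j).re) (hz' : ∀ j, 0 ≤ (z' j).re) :
    eulerFactor' p z z' ≠ 0 ∧
      ‖eulerFactor p W L b z z' / eulerFactor' p z z' - 1‖ ≤ deltaConst m / (p : ℝ) ^ 2 := by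
  have hp2 : 2 ≤ p := by omega
  have hE' := norm_eulerFactor'_ge hp hz hz'
  have hne : eulerFactor' p z z' ≠ 0 := fun h => by rw [h, norm_zero] at hE'; linarith
  refine ⟨hne, ?_⟩
  have h1 := norm_eulerFactor_sub_main_le hpW L b hrow hmin hz hz'
  have h2 := norm_eulerFactor'_sub_main_le hp2 hz hz'
  have hdiff : ‖eulerFactor p W L b z z' - eulerFactor' p z z'‖ ≤
      (4 ^ m + (49 * (m : ℝ) ^ 2 * (9 / 2) ^ m + 8 * m)) / (p : ℝ) ^ 2 := by
    calc ‖eulerFactor p W L b z z' - eulerFactor' p z z'‖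
        = ‖(eulerFactor p W L b z z' - eulerMain p z z') - (eulerFactor' p z z' - eulerMain p z z')‖ := by ring_nf
      _ ≤ ‖eulerFactor p W L b z z' - eulerMain p z z'‖ + ‖eulerFactor' p z z' - eulerMain p z z'‖ := norm_sub_le _ _
      _ ≤ 4 ^ m / (p : ℝ) ^ 2 + (49 * (m : ℝ) ^ 2 * (9 / 2) ^ m + 8 * m) / (p : ℝ) ^ 2 := add_le_add h1 h2
      _ = _ := by ring
  rw [div_sub_one hne, norm_div]
  calc ‖eulerFactor p W L b z z' - eulerFactor' p z z'‖ / ‖eulerFactor' p z z'‖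
      ≤ ((4 ^ m + (49 * (m : ℝ) ^ 2 * (9 / 2) ^ m + 8 * m)) / (p : ℝ) ^ 2) / (1 / 2) := by
        gcongr
    _ = deltaConst m / (p : ℝ) ^ 2 := by unfold deltaConst; ring

/-- `E'_p ≠ 0` for every `p ≥ 2` and `Re z, Re z' ≥ 0` (each factor `(1-a)(1-b)/(1-c)` has
`|a|, |b|, |c| ≤ 1/2`). [cite: ConlonFoxZhao2014, Section 9] -/
theorem eulerFactor'_ne_zero {p : ℕ} (hp : 2 ≤ p) {z z' : Fin m → ℂ} (hz : ∀ j, 0 ≤ (z j).re)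
    (hz' : ∀ j, 0 ≤ (z' j).re) : eulerFactor' p z z' ≠ 0 := by
  have hp0 : 0 < p := by omega
  have hpinv : (1 : ℝ) / p ≤ 1 / 2 := by
    rw [div_le_div_iff₀ (by exact_mod_cast hp0) (by norm_num), one_mul, one_mul]; exact_mod_cast hp
  have hsmall : ∀ w : ℂ, 0 ≤ w.re → ‖(p : ℂ) ^ (-(1 + w))‖ ≤ 1 / 2 := fun w hw =>
    (EulerPrime.norm_cpow_neg_one_add_le hp0 hw).trans hpinv
  have hne : ∀ w : ℂ, 0 ≤ w.re → (1 : ℂ) - (p : ℂ) ^ (-(1 + w)) ≠ 0 := fun w hw h0 => by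
    have := norm_sub_norm_le (1 : ℂ) ((p : ℂ) ^ (-(1 + w)))
    rw [h0, norm_zero, norm_one] at this
    linarith [hsmall w hw]
  unfold eulerFactor'
  refine prod_ne_zero_iff.2 fun j _ => ?_
  refine div_ne_zero (mul_ne_zero (hne _ (hz j)) (hne _ (hz' j))) ?_
  have := hne (z j + z' j) (by rw [Complex.add_re]; linarith [hz j, hz' j])
  simpa [add_assoc] using this

end Pointwise

/-! ### S7 step (vi), the limit `Q → ∞` of `∏_{p<Q} E_p` -/

section Limit

open Filter Topology

/-- The left/right halves of the exponent vector `z(η)`. [cite: ConlonFoxZhao2014, Section 9] -/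
def zL (R : ℝ) (η : Fin m ⊕ Fin m → ℝ) : Fin m → ℂ := fun j => zOf R (η (Sum.inl j))

/-- See `zL`. [cite: ConlonFoxZhao2014, Section 9] -/
def zR (R : ℝ) (η : Fin m ⊕ Fin m → ℝ) : Fin m → ℂ := fun j => zOf R (η (Sum.inr j))

/-- `Re z(η) = 1/log R`. [cite: ConlonFoxZhao2014, Section 9] -/
theorem zOf_re (R η : ℝ) : (zOf R η).re = 1 / Real.log R := by
  simp [zOf, Complex.div_re, Complex.normSq]

variable (R : ℝ) (W : ℕ) {n : ℕ} (L : Fin m → Fin (n + 1) → ℤ) (b : Fin m → ℤ) (w : ℕ)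
  (η : Fin m ⊕ Fin m → ℝ)

/-- The sequence `δ'_q`: `E_q/E'_q - 1` at the primes `q > w`, `0` elsewhere.
[cite: ConlonFoxZhao2014, Section 9] -/
def deltaSeq (q : ℕ) : ℂ :=
  if q.Prime ∧ w < q then
    eulerFactor q W L b (zL R η) (zR R η) / eulerFactor' q (zL R η) (zR R η) - 1
  else 0

/-- **The finite decomposition** for `Q > w`, when `E_p = 1` for the primes `p ≤ w` (those dividing
`W`): `∏_{p<Q} E_p = (∏_{p<Q} E'_p / ∏_{p≤w} E'_p) · ∏_{q<Q} (1 + δ'_q)`.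
[cite: ConlonFoxZhao2014, Section 9] -/
theorem prod_eulerFactor_eq_of_lt (hR : 1 < R) (hW : ∀ p : ℕ, p.Prime → (p ∣ W ↔ p ≤ w)) {Q : ℕ} (hQ : w < Q) :
    ∏ p ∈ Q.primesBelow, eulerFactor p W L b (zL R η) (zR R η) =
      (∏ p ∈ Q.primesBelow, eulerFactor' p (zL R η) (zR R η)) /
          (∏ p ∈ (w + 1).primesBelow, eulerFactor' p (zL R η) (zR R η)) *
        ∏ q ∈ range Q, (1 + deltaSeq R W L b w η q) := by
  classical
  have hlogR : 0 < Real.log R := Real.log_pos hR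
  have hzre : ∀ j, 0 ≤ (zL R η j).re := fun j => by simp only [zL, zOf_re]; positivity
  have hz're : ∀ j, 0 ≤ (zR R η j).re := fun j => by simp only [zR, zOf_re]; positivity
  set E : ℕ → ℂ := fun p => eulerFactor p W L b (zL R η) (zR R η) with hE
  set E' : ℕ → ℂ := fun p => eulerFactor' p (zL R η) (zR R η) with hE'
  -- split the primes below `Q` at `w`
  have hsplit : ∀ f : ℕ → ℂ, ∏ p ∈ Q.primesBelow, f p =
      (∏ p ∈ (Q.primesBelow).filter (fun p => p ≤ w), f p) * ∏ p ∈ (Q.primesBelow).filter (fun p => ¬ p ≤ w), f p :=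
    fun f => (prod_filter_mul_prod_filter_not _ _ _).symm
  have hS₁ : (Q.primesBelow).filter (fun p => p ≤ w) = (w + 1).primesBelow := by
    ext p; simp only [mem_filter, Nat.mem_primesBelow]; constructor
    · rintro ⟨⟨_, hp⟩, hpw⟩; exact ⟨by omega, hp⟩
    · rintro ⟨hpw, hp⟩; exact ⟨⟨by omega, hp⟩, by omega⟩
  -- small primes: `E_p = 1`
  have hsmall : ∏ p ∈ (Q.primesBelow).filter (fun p => p ≤ w), E p = 1 := by
    refine prod_eq_one fun p hp => ?_
    rw [mem_filter, Nat.mem_primesBelow] at hp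
    haveI : Fact p.Prime := ⟨hp.1.2⟩
    exact eulerFactor_eq_one_of_dvd ((hW p hp.1.2).2 hp.2) L b _ _
  -- large primes: `E_p = E'_p (1 + δ_p)`
  have hE'0 : ∀ p ∈ Q.primesBelow, E' p ≠ 0 := fun p hp =>
    eulerFactor'_ne_zero (Nat.mem_primesBelow.1 hp).2.two_le hzre hz're
  have hlarge : ∏ p ∈ (Q.primesBelow).filter (fun p => ¬ p ≤ w), E p =
      (∏ p ∈ (Q.primesBelow).filter (fun p => ¬ p ≤ w), E' p) *
        ∏ p ∈ (Q.primesBelow).filter (fun p => ¬ p ≤ w), E p / E' p := by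
    rw [← prod_mul_distrib]
    exact prod_congr rfl fun p hp => by rw [mul_div_cancel₀ _ (hE'0 p (mem_filter.1 hp).1)]
  -- the `δ'`-product over `range Q`
  have hδ : ∏ q ∈ range Q, (1 + deltaSeq R W L b w η q) =
      ∏ p ∈ (Q.primesBelow).filter (fun p => ¬ p ≤ w), E p / E' p := by
    have h1 : ∀ q, 1 + deltaSeq R W L b w η q = if q.Prime ∧ w < q then E q / E' q else 1 := by
      intro q; unfold deltaSeq; split_ifs <;> ring
    simp_rw [h1]
    rw [← prod_filter]
    refine prod_congr ?_ fun _ _ => rfl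
    ext q
    simp only [mem_filter, mem_range, Nat.mem_primesBelow, not_le]
    tauto
  -- assemble
  have hden : ∏ p ∈ (w + 1).primesBelow, E' p ≠ 0 := prod_ne_zero_iff.2 fun p hp =>
    eulerFactor'_ne_zero (Nat.mem_primesBelow.1 hp).2.two_le hzre hz're
  rw [hsplit E, hsmall, one_mul, hlarge, hδ, hsplit E', hS₁, mul_div_cancel_left₀ _ hden]

/-- **Summability of `δ'`**: `‖δ'_q‖ ≤ deltaConst(m)/q²` for all `q`, once `w ≥ 21m + 2`, `w ≥ 2C²`
(non-degeneracy modulo the primes `> w`) and `p ∣ W ↔ p ≤ w`. [cite: ConlonFoxZhao2014, Section 9] -/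
theorem norm_deltaSeq_le (hR : 1 < R) (hW : ∀ p : ℕ, p.Prime → (p ∣ W ↔ p ≤ w)) (hw : 21 * m + 2 ≤ w)
    {C : ℕ} (hwC : 2 * C ^ 2 ≤ w) (hC : ∀ i j, |L i j| ≤ C) (hL0 : ∀ i, L i ≠ 0)
    (hLp : ∀ i i', i ≠ i' → ∀ c : ℚ, (fun j => (L i j : ℚ)) ≠ c • fun j => (L i' j : ℚ)) (q : ℕ) :
    ‖deltaSeq R W L b w η q‖ ≤ deltaConst m / (q : ℝ) ^ 2 := by
  have hlogR : 0 < Real.log R := Real.log_pos hR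
  have hzre : ∀ j, 0 ≤ (zL R η j).re := fun j => by simp only [zL, zOf_re]; positivity
  have hz're : ∀ j, 0 ≤ (zR R η j).re := fun j => by simp only [zR, zOf_re]; positivity
  unfold deltaSeq
  split_ifs with h
  · obtain ⟨hq, hwq⟩ := h
    haveI : Fact q.Prime := ⟨hq⟩
    have hqW : ¬ q ∣ W := fun hd => by have := (hW q hq).1 hd; omega
    obtain ⟨hrow, hmin⟩ := nondegenerate_mod_of_bounds (p := q) (by omega) L hC hL0 hLp
    exact (norm_eulerFactor_div_sub_one_le hqW (by omega) L b hrow hmin hzre hz're).2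
  · rw [norm_zero]; exact div_nonneg (deltaConst_nonneg m) (sq_nonneg _)

/-- `δ'` is absolutely summable (comparison with `∑ 1/q²`). [cite: ConlonFoxZhao2014, Section 9] -/
theorem summable_norm_deltaSeq (hR : 1 < R) (hW : ∀ p : ℕ, p.Prime → (p ∣ W ↔ p ≤ w)) (hw : 21 * m + 2 ≤ w)
    {C : ℕ} (hwC : 2 * C ^ 2 ≤ w) (hC : ∀ i j, |L i j| ≤ C) (hL0 : ∀ i, L i ≠ 0)
    (hLp : ∀ i i', i ≠ i' → ∀ c : ℚ, (fun j => (L i j : ℚ)) ≠ c • fun j => (L i' j : ℚ)) :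
    Summable fun q => ‖deltaSeq R W L b w η q‖ := by
  have hs : Summable fun q : ℕ => deltaConst m * (1 / (q : ℝ) ^ 2) :=
    (Real.summable_one_div_nat_pow.2 one_lt_two).mul_left _
  refine Summable.of_nonneg_of_le (fun q => norm_nonneg _) (fun q => ?_) hs
  rw [mul_one_div]
  exact norm_deltaSeq_le R W L b w η hR hW hw hwC hC hL0 hLp q

/-- **The limit `Q → ∞`** ("Splitting into prime factors, we obtain `∏_p E_p(ξ)`", made precise):
`∏_{p<Q} E_p → (∏_j ζ(1+z_j+z'_j)/(ζ(1+z_j)ζ(1+z'_j))) / ∏_{p≤w} E'_p · ∏'_q (1 + δ'_q)`.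
[cite: ConlonFoxZhao2014, Section 9] -/
theorem tendsto_prod_eulerFactor (hR : 1 < R) (hW : ∀ p : ℕ, p.Prime → (p ∣ W ↔ p ≤ w))
    (hsum : Summable fun q => ‖deltaSeq R W L b w η q‖) :
    Tendsto (fun Q : ℕ => ∏ p ∈ Q.primesBelow, eulerFactor p W L b (zL R η) (zR R η)) atTop
      (𝓝 ((∏ j, riemannZeta (1 + zL R η j + zR R η j) / (riemannZeta (1 + zL R η j) * riemannZeta (1 + zR R η j))) /
          (∏ p ∈ (w + 1).primesBelow, eulerFactor' p (zL R η) (zR R η)) *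
        ∏' q, (1 + deltaSeq R W L b w η q))) := by
  have hlogR : 0 < Real.log R := Real.log_pos hR
  have hzre : ∀ j, 0 < (zL R η j).re := fun j => by simp only [zL, zOf_re]; positivity
  have hz're : ∀ j, 0 < (zR R η j).re := fun j => by simp only [zR, zOf_re]; positivity
  have h1 := ((tendsto_prod_eulerFactor' hzre hz're).div_const
    (∏ p ∈ (w + 1).primesBelow, eulerFactor' p (zL R η) (zR R η))).mul
    (multipliable_one_add_of_summable hsum).hasProd.tendsto_prod_nat
  refine h1.congr' ?_
  filter_upwards [eventually_gt_atTop w] with Q hQ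
  exact (prod_eulerFactor_eq_of_lt R W L b w η hR hW hQ).symm

end Limit

/-! ### S7 step (vi), integrated: dominated convergence on the box -/

section Dominated

open Filter Topology MeasureTheory

/-- `|E_p(z, z')| ≤ E⁺_p(s)` when all exponents have real part `s`.
[cite: ConlonFoxZhao2014, Section 9, Error estimates, Estimate (32)] -/
theorem norm_eulerFactor_le_abs (p W : ℕ) (hp : 0 < p) (L : Fin m → Fin t → ℤ) (b : Fin m → ℤ)
    {z z' : Fin m → ℂ} {s : ℝ} (hre : ∀ v, (sumExp z z' v).re = s) :
    ‖eulerFactor p W L b z z'‖ ≤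
      ∑ Y : Finset (Fin m ⊕ Fin m), localDensity₀ p W L b (projPattern Y) * ∏ _v ∈ Y, (p : ℝ) ^ (-s) := by
  unfold eulerFactor
  refine (norm_sum_le _ _).trans (sum_le_sum fun Y _ => ?_)
  rw [norm_mul, Complex.norm_real, Real.norm_eq_abs, abs_of_nonneg (localDensity₀_nonneg_le_one p W L b _).1,
    norm_prod]
  refine mul_le_mul_of_nonneg_left (le_of_eq (prod_congr rfl fun v _ => ?_)) (localDensity₀_nonneg_le_one p W L b _).1
  rw [norm_neg, Complex.norm_natCast_cpow_of_pos hp, Complex.neg_re, hre v]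

/-- `E_p(z(η))` is continuous in `η`. [cite: ConlonFoxZhao2014, Section 9] -/
theorem continuous_eulerFactor_zOf (R : ℝ) (p W : ℕ) (hp : 0 < p) (L : Fin m → Fin t → ℤ) (b : Fin m → ℤ) :
    Continuous fun η : Fin m ⊕ Fin m → ℝ => eulerFactor p W L b (zL R η) (zR R η) := by
  unfold eulerFactor
  refine continuous_finsetSum _ fun Y _ => continuous_const.mul (continuous_finsetProd _ fun v _ => ?_)
  refine Continuous.neg (Continuous.const_cpow ?_ (Or.inl (by exact_mod_cast hp.ne')))
  have : (fun η : Fin m ⊕ Fin m → ℝ => -(sumExp (zL R η) (zR R η) v)) = fun η => -(zOf R (η v)) := by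
    funext η; rcases v with j | j <;> rfl
  rw [this]
  exact ((continuous_zOf R).comp (continuous_apply v)).neg

variable {χ : ℝ → ℝ} (hs : ContDiff ℝ (⊤ : ℕ∞) χ) (hsupp : ∀ x, 1 ≤ |x| → χ x = 0)

include hs hsupp in
/-- **`I_Q → I_∞`**: the box integrals of `(∏_v φ(η_v)) ∏_{p<Q} E_p(z(η))` converge to the box
integral of the pointwise limit, by dominated convergence with a constant dominator
(`‖∏ φ‖ ≤ C₀^{2m}`, `|∏_{p<Q} E_p| ≤ ∏_{p<Q} E⁺_p(s) ≤ B`). [cite: ConlonFoxZhao2014, Section 9] -/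
theorem tendsto_integral_prod_eulerFactor (R T : ℝ) (W : ℕ) {n : ℕ} (L : Fin m → Fin (n + 1) → ℤ)
    (b : Fin m → ℤ) {B : ℝ}
    (hB : ∀ (Q : ℕ) (η : Fin m ⊕ Fin m → ℝ),
      ‖∏ p ∈ Q.primesBelow, eulerFactor p W L b (zL R η) (zR R η)‖ ≤ B)
    (hlim : ∀ η : Fin m ⊕ Fin m → ℝ, ∃ l : ℂ,
      Tendsto (fun Q : ℕ => ∏ p ∈ Q.primesBelow, eulerFactor p W L b (zL R η) (zR R η)) atTop (𝓝 l)) :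
    Tendsto (fun Q : ℕ => ∫ η, (∏ v, phiF χ (η v)) * ∏ p ∈ Q.primesBelow, eulerFactor p W L b (zL R η) (zR R η)
        ∂(boxMeasure m T)) atTop
      (𝓝 (∫ η, (∏ v, phiF χ (η v)) * (hlim η).choose ∂(boxMeasure m T))) := by
  obtain ⟨C₀, hC₀, hφ⟩ := norm_phiF_le hs hsupp 0
  have hφc : Continuous (phiF χ) := by rw [← phiS_coe hs hsupp]; exact (phiS hs hsupp).continuous
  have hΦc : Continuous fun η : Fin m ⊕ Fin m → ℝ => ∏ v, phiF χ (η v) :=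
    continuous_finsetProd _ fun v _ => hφc.comp (continuous_apply v)
  have hΦb : ∀ η : Fin m ⊕ Fin m → ℝ, ‖∏ v, phiF χ (η v)‖ ≤ C₀ ^ Fintype.card (Fin m ⊕ Fin m) := by
    intro η
    rw [norm_prod]
    calc ∏ v, ‖phiF χ (η v)‖ ≤ ∏ _v : Fin m ⊕ Fin m, C₀ :=
          prod_le_prod (fun v _ => norm_nonneg _) fun v _ => by
            have h1 := hφ (η v); simp only [pow_zero, inv_one, mul_one] at h1; exact h1
      _ = C₀ ^ Fintype.card (Fin m ⊕ Fin m) := by rw [prod_const, card_univ]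
  have hB0 : 0 ≤ B := (norm_nonneg _).trans (hB 0 0)
  refine tendsto_integral_of_dominated_convergence (fun _ => C₀ ^ Fintype.card (Fin m ⊕ Fin m) * B)
    (fun Q => ?_) (integrable_const _) (fun Q => Filter.Eventually.of_forall fun η => ?_)
    (Filter.Eventually.of_forall fun η => ?_)
  · refine (hΦc.mul ?_).aestronglyMeasurable
    exact continuous_finsetProd _ fun p hp =>
      continuous_eulerFactor_zOf R p W (Nat.mem_primesBelow.1 hp).2.pos L b
  · rw [norm_mul]
    exact mul_le_mul (hΦb η) (hB Q η) (norm_nonneg _) (by positivity)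
  · exact tendsto_const_nhds.mul (hlim η).choose_spec

end Dominated

/-! ### S7 step (vii), first pieces: the correction product `Π = ∏' (1 + δ'_q)` is `1 + O(1/w)` -/

section Correction

open Filter Topology

/-- In the limit: `‖∏'_q (1 + δ_q) - 1‖ ≤ exp(∑'_q ‖δ_q‖) - 1` for absolutely summable `δ`.
[cite: ConlonFoxZhao2014, Section 9] -/
theorem norm_tprod_one_add_sub_one_le (δ : ℕ → ℂ) (hδ : Summable fun q => ‖δ q‖) :
    ‖∏' q, (1 + δ q) - 1‖ ≤ Real.exp (∑' q, ‖δ q‖) - 1 := by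
  have hlim := (multipliable_one_add_of_summable hδ).hasProd.tendsto_prod_nat
  have hcont : Continuous fun x : ℂ => ‖x - 1‖ := (continuous_id.sub continuous_const).norm
  refine le_of_tendsto' ((hcont.tendsto _).comp hlim) fun Q => ?_
  refine (Finset.norm_prod_one_add_sub_one_le (range Q) δ).trans (sub_le_sub_right ?_ _)
  exact Real.exp_le_exp.2 (hδ.sum_le_tsum (range Q) fun q _ => norm_nonneg _)

/-- `∑_{w < q < N} 1/q² ≤ 1/w` (telescoping with `1/q² ≤ 1/(q-1) - 1/q`). [folklore] -/
theorem sum_range_inv_sq_tail_le {w : ℕ} (hw : 1 ≤ w) (N : ℕ) :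
    ∑ q ∈ range N, (if w < q then 1 / (q : ℝ) ^ 2 else 0) ≤ (1 : ℝ) / w := by
  set g : ℕ → ℝ := fun q => if w < q then 1 / ((q : ℝ) - 1) else 1 / w with hg
  have hw1 : (1 : ℝ) ≤ w := by exact_mod_cast hw
  have hstep : ∀ q : ℕ, (if w < q then 1 / (q : ℝ) ^ 2 else 0) ≤ g q - g (q + 1) := by
    intro q
    by_cases hq : w < q
    · have hq1 : w < q + 1 := by omega
      have hqr : (w : ℝ) + 1 ≤ q := by exact_mod_cast hq
      simp only [hg, if_pos hq, if_pos hq1]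
      push_cast
      rw [add_sub_cancel_right]
      have hq0 : (0 : ℝ) < (q : ℝ) - 1 := by linarith
      have hqpos : (0 : ℝ) < q := by linarith
      have key : 1 / ((q : ℝ) - 1) - 1 / (q : ℝ) = 1 / (((q : ℝ) - 1) * q) := by
        rw [div_sub_div _ _ hq0.ne' hqpos.ne', eq_div_iff (mul_pos hq0 hqpos).ne',
          div_mul_cancel₀ _ (mul_pos hq0 hqpos).ne']
        ring
      rw [key]
      exact one_div_le_one_div_of_le (mul_pos hq0 hqpos) (by nlinarith)
    · simp only [hg, if_neg hq]
      by_cases hq1 : w < q + 1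
      · have : q = w := by omega
        subst this
        simp only [if_pos hq1]
        push_cast; rw [add_sub_cancel_right]; linarith
      · simp only [if_neg hq1]; linarith
  have hg0 : g 0 = 1 / w := by simp [hg]
  have hgN : 0 ≤ g N := by
    simp only [hg]
    split_ifs with h
    · have : (w : ℝ) + 1 ≤ N := by exact_mod_cast h
      exact div_nonneg zero_le_one (by linarith)
    · positivity
  calc ∑ q ∈ range N, (if w < q then 1 / (q : ℝ) ^ 2 else 0) ≤ ∑ q ∈ range N, (g q - g (q + 1)) :=
        sum_le_sum fun q _ => hstep q
    _ = g 0 - g N := sum_range_sub' g N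
    _ ≤ 1 / w := by rw [hg0]; linarith

/-- **`Π = 1 + O(1/w)`**: if `‖δ'_q‖ ≤ D/q²` for `q > w` and `δ'_q = 0` for `q ≤ w`, then
`∑' ‖δ'‖ ≤ D/w` and hence `‖∏'(1 + δ') - 1‖ ≤ exp(D/w) - 1`. [cite: ConlonFoxZhao2014, Section 9] -/
theorem norm_tprod_sub_one_le_of_sq_decay (δ : ℕ → ℂ) {D : ℝ} (hD : 0 ≤ D) {w : ℕ} (hw : 1 ≤ w)
    (hsmall : ∀ q, q ≤ w → δ q = 0) (hdecay : ∀ q, w < q → ‖δ q‖ ≤ D / (q : ℝ) ^ 2) :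
    (Summable fun q => ‖δ q‖) ∧ ∑' q, ‖δ q‖ ≤ D / w ∧ ‖∏' q, (1 + δ q) - 1‖ ≤ Real.exp (D / (w : ℝ)) - 1 := by
  have hle : ∀ q, ‖δ q‖ ≤ D * (if w < q then 1 / (q : ℝ) ^ 2 else 0) := by
    intro q
    by_cases hq : w < q
    · rw [if_pos hq, mul_one_div]; exact hdecay q hq
    · rw [if_neg hq, mul_zero, hsmall q (not_lt.1 hq), norm_zero]
  have hpart : ∀ N, ∑ q ∈ range N, ‖δ q‖ ≤ D / w := fun N =>
    calc ∑ q ∈ range N, ‖δ q‖ ≤ ∑ q ∈ range N, D * (if w < q then 1 / (q : ℝ) ^ 2 else 0) := sum_le_sum fun q _ => hle q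
      _ = D * ∑ q ∈ range N, (if w < q then 1 / (q : ℝ) ^ 2 else 0) := (mul_sum _ _ _).symm
      _ ≤ D * (1 / w) := mul_le_mul_of_nonneg_left (sum_range_inv_sq_tail_le hw N) hD
      _ = D / w := mul_one_div _ _
  have hsum : Summable fun q => ‖δ q‖ := by
    refine Summable.of_nonneg_of_le (fun q => norm_nonneg _) hle ?_
    refine Summable.mul_left _ ?_
    refine Summable.of_nonneg_of_le (fun q => by positivity) (fun q => ?_)
      (Real.summable_one_div_nat_pow.2 one_lt_two)
    split_ifs <;> first | exact le_rfl | positivity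
  have htsum : ∑' q, ‖δ q‖ ≤ D / w := Real.tsum_le_of_sum_range_le (fun q => norm_nonneg _) hpart
  exact ⟨hsum, htsum, (norm_tprod_one_add_sub_one_le δ hsum).trans
    (sub_le_sub_right (Real.exp_le_exp.2 htsum) _)⟩

end Correction

/-! ### S7 step (vii), tools: `φ(W)/W` as an Euler product, and a three-factor perturbation bound -/

/-- **`φ(W)/W = ∏_{p ≤ w} (1 - 1/p)`** for `W = ∏_{p ≤ w} p` (CFZ (36), the right-hand side).
[cite: ConlonFoxZhao2014, Section 9, equation (36)] -/
theorem totient_primorial_div (w : ℕ) :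
    ((Nat.totient (primorial w) : ℝ) / primorial w) = ∏ p ∈ (w + 1).primesBelow, (1 - (p : ℝ)⁻¹) := by
  have hW : (0 : ℝ) < primorial w := by exact_mod_cast primorial_pos w
  have h := Nat.totient_eq_mul_prod_factors (primorial w)
  rw [primeFactors_primorial] at h
  change _ = _ * ∏ p ∈ (w + 1).primesBelow, _ at h
  have h' := congrArg (fun q : ℚ => (q : ℝ)) h
  push_cast at h'
  rw [div_eq_iff hW.ne', mul_comm]
  exact h'

/-- Three perturbed factors: if `‖A - 1‖ ≤ α`, `‖B - 1‖ ≤ β ≤ 1/2`, `‖C - 1‖ ≤ γ`, then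
`‖A B⁻¹ C - 1‖ ≤ (1 + α)(1 + 2β)(1 + γ) - 1`. [folklore] -/
theorem norm_mul_inv_mul_sub_one_le {A B C : ℂ} {α β γ : ℝ} (hA : ‖A - 1‖ ≤ α) (hB : ‖B - 1‖ ≤ β)
    (hβ : β ≤ 1 / 2) (hC : ‖C - 1‖ ≤ γ) :
    ‖A * B⁻¹ * C - 1‖ ≤ (1 + α) * (1 + 2 * β) * (1 + γ) - 1 := by
  -- `‖B⁻¹ - 1‖ ≤ 2β`
  have hBn : (1 : ℝ) / 2 ≤ ‖B‖ := by
    have := norm_sub_norm_le (1 : ℂ) (1 - B); rw [sub_sub_cancel, norm_one, norm_sub_rev] at this; linarith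
  have hB0 : B ≠ 0 := fun h => by rw [h, norm_zero] at hBn; linarith
  have hBinv : ‖B⁻¹ - 1‖ ≤ 2 * β := by
    have hid : B⁻¹ - 1 = (1 - B) * B⁻¹ := by field_simp
    rw [hid, norm_mul, norm_inv, norm_sub_rev]
    calc ‖B - 1‖ * ‖B‖⁻¹ ≤ β * (1 / 2)⁻¹ := by
          gcongr
          · exact (norm_nonneg _).trans hB
        _ = 2 * β := by ring
  -- expand `A B⁻¹ C - 1` as a product of `(1 + ·)`'s
  classical
  have key := norm_prod_add_sub_prod_le (univ : Finset (Fin 3)) (fun _ => (1 : ℂ)) (![A - 1, B⁻¹ - 1, C - 1])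
    (X := fun _ => 1) (Y := ![α, 2 * β, γ]) (fun _ _ => by simp) (fun i _ => by
      fin_cases i <;> simpa using (by first | exact hA | exact hBinv | exact hC))
  simp only [prod_const_one, Fin.prod_univ_three, Matrix.cons_val_zero, Matrix.cons_val_one,
    Matrix.cons_val_two, Matrix.head_cons, Matrix.tail_cons, add_sub_cancel] at key
  exact key

/-! ### S7 step (vii), pointwise: the limit against the main term -/

section MainPointwise

open EulerPrime

/-- The main exponent product `∏_j z_j z'_j/(z_j + z'_j)` at `z = z(η)`. [cite: ConlonFoxZhao2014, Section 9] -/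
def mainZ (R : ℝ) (η : Fin m ⊕ Fin m → ℝ) : ℂ :=
  ∏ j, zL R η j * zR R η j / (zL R η j + zR R η j)

/-- The zeta-ratio product `∏_j ζ(1+z_j+z'_j)/(ζ(1+z_j)ζ(1+z'_j))` at `z = z(η)`.
[cite: ConlonFoxZhao2014, Section 9] -/
def zetaRatio (R : ℝ) (η : Fin m ⊕ Fin m → ℝ) : ℂ :=
  ∏ j, riemannZeta (1 + zL R η j + zR R η j) / (riemannZeta (1 + zL R η j) * riemannZeta (1 + zR R η j))

/-- `‖z(x)‖ ≤ (1 + 2π|x|)/log R` for `R > 1`. [cite: ConlonFoxZhao2014, Section 9] -/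
theorem norm_zOf_le {R : ℝ} (hR : 1 < R) (x : ℝ) : ‖zOf R x‖ ≤ (1 + 2 * Real.pi * |x|) / Real.log R := by
  have hlogR : 0 < Real.log R := Real.log_pos hR
  unfold zOf
  rw [norm_div, Complex.norm_real, Real.norm_eq_abs, abs_of_pos hlogR]
  gcongr
  calc ‖(1 : ℂ) - 2 * Real.pi * x * Complex.I‖ ≤ ‖(1 : ℂ)‖ + ‖2 * (Real.pi : ℂ) * x * Complex.I‖ := norm_sub_le _ _
    _ = 1 + 2 * Real.pi * |x| := by
        rw [norm_one, norm_mul, norm_mul, norm_mul, Complex.norm_I, Complex.norm_real, Complex.norm_real,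
          Real.norm_eq_abs, Real.norm_eq_abs, abs_of_pos Real.pi_pos, Complex.norm_ofNat]
        ring

/-- `z(x) ≠ 0` and `z(x) + z(y) ≠ 0` (`Re = 1/log R > 0`). [cite: ConlonFoxZhao2014, Section 9] -/
theorem zOf_ne_zero {R : ℝ} (hR : 1 < R) (x y : ℝ) : zOf R x ≠ 0 ∧ zOf R x + zOf R y ≠ 0 := by
  have hlogR : 0 < Real.log R := Real.log_pos hR
  have hre : 0 < (zOf R x).re := by rw [zOf_re]; positivity
  have hre' : 0 < (zOf R x + zOf R y).re := by rw [Complex.add_re, zOf_re, zOf_re]; positivity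
  exact ⟨fun h => by rw [h] at hre; simp at hre, fun h => by rw [h] at hre'; simp at hre'⟩

/-- **Pointwise comparison of the limit with the main term** (CFZ (34)–(36) combined): with
`Lim = zetaRatio / ∏_{p≤w} E'_p · P`, `P = ∏'(1 + δ')`, on the box `|η_v| ≤ T`:
`‖Lim - mainZ · (W/φ(W))^m‖ ≤ ((1+α)(1+2β)(1+γ) - 1) · ‖mainZ‖ (W/φ(W))^m`, where
`α = (1 + Kδ)^m - 1` (zeta ratio, `δ = (1+2πT)/log R ≤ δ₀`), `β = (1+U)^{#S} - 1 ≤ 1/2`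
(small primes, `U = (1 + 144 δ log w)^m - 1`, `2δ log w ≤ 1/8`) and `γ` bounds `‖P - 1‖`.
[cite: ConlonFoxZhao2014, Section 9] -/
theorem norm_limit_sub_main_le {δ₀ K : ℝ}
    (hζ : ∀ z z' : ℂ, z ≠ 0 → z' ≠ 0 → z + z' ≠ 0 → ∀ δ : ℝ, δ ≤ δ₀ → ‖z‖ ≤ δ → ‖z'‖ ≤ δ →
      ‖riemannZeta (1 + z + z') / (riemannZeta (1 + z) * riemannZeta (1 + z')) - z * z' / (z + z')‖ ≤
        K * δ * ‖z * z' / (z + z')‖)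
    {R T : ℝ} (hR : 1 < R) (hT : 0 ≤ T) (hδ₀ : (1 + 2 * Real.pi * T) / Real.log R ≤ δ₀)
    {w : ℕ} (hδw : 2 * ((1 + 2 * Real.pi * T) / Real.log R) * Real.log w ≤ 1 / 8)
    (hβ : (1 + ((1 + 144 * ((1 + 2 * Real.pi * T) / Real.log R) * Real.log w) ^ m - 1)) ^ #((w + 1).primesBelow) - 1 ≤ 1 / 2)
    (η : Fin m ⊕ Fin m → ℝ) (hη : ∀ v, |η v| ≤ T) (P : ℂ) {γ : ℝ} (hPcorr : ‖P - 1‖ ≤ γ) :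
    ‖zetaRatio R η / (∏ p ∈ (w + 1).primesBelow, eulerFactor' p (zL R η) (zR R η)) * P -
        mainZ R η * ((((Nat.totient (primorial w) : ℝ) / primorial w) ^ m)⁻¹ : ℝ)‖ ≤
      ((1 + ((1 + K * ((1 + 2 * Real.pi * T) / Real.log R)) ^ m - 1)) *
          (1 + 2 * ((1 + ((1 + 144 * ((1 + 2 * Real.pi * T) / Real.log R) * Real.log w) ^ m - 1)) ^
            #((w + 1).primesBelow) - 1)) * (1 + γ) - 1) *
        (‖mainZ R η‖ * ((((Nat.totient (primorial w) : ℝ) / primorial w) ^ m)⁻¹)) := by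
  classical
  have hlogR : 0 < Real.log R := Real.log_pos hR
  set δ : ℝ := (1 + 2 * Real.pi * T) / Real.log R with hδ_def
  set S := (w + 1).primesBelow with hS_def
  set U : ℝ := (1 + 144 * δ * Real.log w) ^ m - 1 with hU_def
  set α : ℝ := (1 + K * δ) ^ m - 1 with hα_def
  set β : ℝ := (1 + U) ^ #S - 1 with hβ_def
  have hδ0 : 0 ≤ δ := by positivity
  -- sizes of the exponents on the box
  have hzl : ∀ j, ‖zL R η j‖ ≤ δ := fun j => (norm_zOf_le hR _).trans (by
    rw [hδ_def]; gcongr; exact hη _)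
  have hzr : ∀ j, ‖zR R η j‖ ≤ δ := fun j => (norm_zOf_le hR _).trans (by
    rw [hδ_def]; gcongr; exact hη _)
  -- (A) zeta ratio: `zetaRatio = mainZ · A`, `‖A - 1‖ ≤ α`
  have hzl0 : ∀ j, zL R η j ≠ 0 := fun j => (zOf_ne_zero hR (η (Sum.inl j)) 0).1
  have hzr0 : ∀ j, zR R η j ≠ 0 := fun j => (zOf_ne_zero hR (η (Sum.inr j)) 0).1
  have hsum0 : ∀ j, zL R η j + zR R η j ≠ 0 := fun j => (zOf_ne_zero hR (η (Sum.inl j)) (η (Sum.inr j))).2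
  have hM0 : ∀ j, zL R η j * zR R η j / (zL R η j + zR R η j) ≠ 0 := fun j =>
    div_ne_zero (mul_ne_zero (hzl0 j) (hzr0 j)) (hsum0 j)
  set e : Fin m → ℂ := fun j =>
    riemannZeta (1 + zL R η j + zR R η j) / (riemannZeta (1 + zL R η j) * riemannZeta (1 + zR R η j)) /
      (zL R η j * zR R η j / (zL R η j + zR R η j)) - 1 with he
  have he_le : ∀ j ∈ (univ : Finset (Fin m)), ‖e j‖ ≤ K * δ := by
    intro j _
    have h := hζ (zL R η j) (zR R η j) (hzl0 j) (hzr0 j) (hsum0 j) δ hδ₀ (hzl j) (hzr j)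
    simp only [he]
    rw [div_sub_one (hM0 j), norm_div, div_le_iff₀ (norm_pos_iff.2 (hM0 j))]
    exact h
  set A : ℂ := ∏ j, (1 + e j) with hA
  have hZR : zetaRatio R η = mainZ R η * A := by
    unfold zetaRatio mainZ
    rw [hA, ← prod_mul_distrib]
    refine Fintype.prod_congr _ _ fun j => ?_
    simp only [he]; rw [add_sub_cancel, mul_div_cancel₀ _ (hM0 j)]
  have hA1 : ‖A - 1‖ ≤ α := by
    have := norm_prod_one_add_sub_one_le univ e he_le
    rwa [card_univ, Fintype.card_fin] at this
  -- (B) small primes: `SP = GW · B`, `‖B - 1‖ ≤ β`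
  set GW : ℝ := ∏ p ∈ S, (1 - (p : ℝ)⁻¹) ^ m with hGW
  have hGWpos : 0 < GW := prod_pos fun p hp => pow_pos (by
    have hp2 : (2 : ℝ) ≤ p := by exact_mod_cast (Nat.mem_primesBelow.1 hp).2.two_le
    have : (p : ℝ)⁻¹ ≤ 1 / 2 := by rw [inv_eq_one_div]; exact one_div_le_one_div_of_le (by norm_num) hp2
    linarith) _
  have hGWC : (∏ p ∈ S, ((1 - (p : ℂ)⁻¹) ^ m)) = ((GW : ℝ) : ℂ) := by
    rw [hGW]; push_cast; rfl
  have hGWeq : ((Nat.totient (primorial w) : ℝ) / primorial w) ^ m = GW := by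
    rw [totient_primorial_div, hGW, ← prod_pow]
  have hSP := norm_prod_eulerFactor'_sub_le S (fun p hp => (Nat.mem_primesBelow.1 hp).2.two_le) hzl hzr
    (U := U) (fun p hp => (by
      have hpw : (p : ℝ) ≤ w := by exact_mod_cast Nat.le_of_lt_succ (Nat.mem_primesBelow.1 hp).1
      have hp1 : (1 : ℝ) ≤ p := by exact_mod_cast (Nat.mem_primesBelow.1 hp).2.one_lt.le
      have : Real.log p ≤ Real.log w := Real.log_le_log (by linarith) hpw
      nlinarith [Real.log_nonneg hp1]))
    (fun p hp => by
      have hpw : (p : ℝ) ≤ w := by exact_mod_cast Nat.le_of_lt_succ (Nat.mem_primesBelow.1 hp).1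
      have hp1 : (1 : ℝ) ≤ p := by exact_mod_cast (Nat.mem_primesBelow.1 hp).2.one_lt.le
      have hlogp : 0 ≤ Real.log p := Real.log_nonneg hp1
      have h1 : Real.log p / p ≤ Real.log w := by
        rw [div_le_iff₀ (by linarith)]
        calc Real.log p ≤ Real.log w := Real.log_le_log (by linarith) hpw
          _ = Real.log w * 1 := (mul_one _).symm
          _ ≤ Real.log w * p := by gcongr
      rw [hU_def]
      gcongr (1 + ?_) ^ m - 1
      rw [mul_div_assoc]
      gcongr)
  rw [hGWC] at hSP
  set SP : ℂ := ∏ p ∈ S, eulerFactor' p (zL R η) (zR R η) with hSPdef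
  set B : ℂ := SP / ((GW : ℝ) : ℂ) with hB
  have hGWC0 : ((GW : ℝ) : ℂ) ≠ 0 := by exact_mod_cast hGWpos.ne'
  have hSPB : SP = ((GW : ℝ) : ℂ) * B := by rw [hB, mul_div_cancel₀ _ hGWC0]
  have hB1 : ‖B - 1‖ ≤ β := by
    rw [hB, div_sub_one hGWC0, norm_div, Complex.norm_real, Real.norm_eq_abs, abs_of_pos hGWpos,
      div_le_iff₀ hGWpos]
    exact hSP
  -- (C) assemble
  have hβ' : β ≤ 1 / 2 := hβ
  have hkey := norm_mul_inv_mul_sub_one_le hA1 hB1 hβ' hPcorr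
  have hBne : B ≠ 0 := by
    intro h0; rw [h0, zero_sub, norm_neg, norm_one] at hB1; linarith
  have hid : zetaRatio R η / SP * P - mainZ R η * (((GW ^ 1)⁻¹ : ℝ) : ℂ) =
      mainZ R η * (((GW : ℝ) : ℂ))⁻¹ * (A * B⁻¹ * P - 1) := by
    rw [hZR, hSPB, pow_one]; push_cast; field_simp
  rw [hGWeq]
  rw [show ((GW⁻¹ : ℝ) : ℂ) = (((GW ^ 1)⁻¹ : ℝ) : ℂ) by rw [pow_one], hid, norm_mul, norm_mul, norm_inv,
    Complex.norm_real, Real.norm_eq_abs, abs_of_pos hGWpos]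
  calc ‖mainZ R η‖ * GW⁻¹ * ‖A * B⁻¹ * P - 1‖ ≤ ‖mainZ R η‖ * GW⁻¹ * ((1 + α) * (1 + 2 * β) * (1 + γ) - 1) := by
        gcongr
    _ = ((1 + α) * (1 + 2 * β) * (1 + γ) - 1) * (‖mainZ R η‖ * GW⁻¹) := by ring

end MainPointwise

/-! ### S7 step (vii), integrated: sizes of the main term -/

section MainIntegrated

open MeasureTheory

/-- `‖mainZ(η)‖ ≤ (2 log R)^{-m} ∏_v (1 + 2π|η_v|)` (`|z z'/(z+z')| ≤ |z||z'| log R/2` as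
`Re(z + z') = 2/log R`). [cite: ConlonFoxZhao2014, Section 9] -/
theorem norm_mainZ_le {R : ℝ} (hR : 1 < R) (η : Fin m ⊕ Fin m → ℝ) :
    ‖mainZ R η‖ ≤ ((2 * Real.log R) ^ m)⁻¹ * ∏ v, (1 + 2 * Real.pi * |η v|) := by
  have hlogR : 0 < Real.log R := Real.log_pos hR
  unfold mainZ
  rw [norm_prod, Fintype.prod_sum_type, ← prod_mul_distrib]
  -- per `j`: `‖z z'/(z+z')‖ ≤ (2 log R)⁻¹ (1+2π|x|)(1+2π|y|)`
  have hj : ∀ j, ‖zL R η j * zR R η j / (zL R η j + zR R η j)‖ ≤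
      (2 * Real.log R)⁻¹ * ((1 + 2 * Real.pi * |η (Sum.inl j)|) * (1 + 2 * Real.pi * |η (Sum.inr j)|)) := by
    intro j
    have hsum : 2 / Real.log R ≤ ‖zL R η j + zR R η j‖ := by
      have h := Complex.abs_re_le_norm (zL R η j + zR R η j)
      rw [Complex.add_re, show (zL R η j).re = 1 / Real.log R from zOf_re _ _,
        show (zR R η j).re = 1 / Real.log R from zOf_re _ _] at h
      rw [show (2 : ℝ) / Real.log R = |1 / Real.log R + 1 / Real.log R| by
        rw [abs_of_pos (by positivity)]; ring]
      exact h
    have hpos : 0 < ‖zL R η j + zR R η j‖ := lt_of_lt_of_le (by positivity) hsum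
    rw [norm_div, norm_mul, div_le_iff₀ hpos]
    have h1 := norm_zOf_le hR (η (Sum.inl j))
    have h2 := norm_zOf_le hR (η (Sum.inr j))
    calc ‖zL R η j‖ * ‖zR R η j‖ ≤ ((1 + 2 * Real.pi * |η (Sum.inl j)|) / Real.log R) *
          ((1 + 2 * Real.pi * |η (Sum.inr j)|) / Real.log R) :=
          mul_le_mul h1 h2 (norm_nonneg _) (by positivity)
      _ = (2 * Real.log R)⁻¹ * ((1 + 2 * Real.pi * |η (Sum.inl j)|) * (1 + 2 * Real.pi * |η (Sum.inr j)|)) *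
            (2 / Real.log R) := by field_simp
      _ ≤ (2 * Real.log R)⁻¹ * ((1 + 2 * Real.pi * |η (Sum.inl j)|) * (1 + 2 * Real.pi * |η (Sum.inr j)|)) *
            ‖zL R η j + zR R η j‖ := by gcongr
  calc ∏ j, ‖zL R η j * zR R η j / (zL R η j + zR R η j)‖
      ≤ ∏ j, ((2 * Real.log R)⁻¹ * ((1 + 2 * Real.pi * |η (Sum.inl j)|) * (1 + 2 * Real.pi * |η (Sum.inr j)|))) :=
        prod_le_prod (fun j _ => norm_nonneg _) fun j _ => hj j
    _ = ((2 * Real.log R) ^ m)⁻¹ * ∏ j, (1 + 2 * Real.pi * |η (Sum.inl j)|) * (1 + 2 * Real.pi * |η (Sum.inr j)|) := by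
        rw [prod_mul_distrib, prod_const, card_univ, Fintype.card_fin, inv_pow]

/-- Generic integration of a pointwise relative bound: if `‖Lim - c·main‖ ≤ E·c·‖main‖` a.e., then
`‖∫ Φ Lim - c ∫ Φ main‖ ≤ E c ∫ ‖Φ‖ ‖main‖`. [folklore] -/
theorem norm_integral_sub_le_of_pointwise {α : Type*} [MeasurableSpace α] {μ : Measure α}
    (Φ Lim main : α → ℂ) {c E : ℝ}
    (hLim : Integrable (fun a => Φ a * Lim a) μ) (hmain : Integrable (fun a => Φ a * main a) μ)
    (hnorm : Integrable (fun a => ‖Φ a‖ * ‖main a‖) μ)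
    (hpt : ∀ᵐ a ∂μ, ‖Lim a - c * main a‖ ≤ E * (‖main a‖ * c)) :
    ‖(∫ a, Φ a * Lim a ∂μ) - c * ∫ a, Φ a * main a ∂μ‖ ≤ E * c * ∫ a, ‖Φ a‖ * ‖main a‖ ∂μ := by
  have h1 : (∫ a, Φ a * Lim a ∂μ) - c * ∫ a, Φ a * main a ∂μ = ∫ a, Φ a * (Lim a - c * main a) ∂μ := by
    rw [← integral_const_mul, ← integral_sub hLim (hmain.const_mul _)]
    refine integral_congr_ae (Filter.Eventually.of_forall fun a => ?_)
    push_cast; ring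
  rw [h1, ← integral_const_mul]
  refine norm_integral_le_of_norm_le (hnorm.const_mul _) ?_
  filter_upwards [hpt] with a ha
  rw [norm_mul]
  calc ‖Φ a‖ * ‖Lim a - c * main a‖ ≤ ‖Φ a‖ * (E * (‖main a‖ * c)) := by gcongr
    _ = E * c * (‖Φ a‖ * ‖main a‖) := by ring

end MainIntegrated

/-! ### S7, simplified route: no truncation of the Fourier integral

`χ(log d/log R) = ∫_ℝ φ(η) d^{-z(η)} dη` holds exactly and the sum over the tuples is finite, so the
expanded sum equals the integral over all of `ℝ^{[m] ⊔ [m]}` of `(∏_v φ(η_v)) ∏_{p<Q} E_p(z(η))` exactly,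
for every finite set of primes `P ⊇ {p ≤ R}`; the truncation of CFZ (30) is then only needed inside
the main-term analysis (where its tails are soft). -/

section Untruncated

open MeasureTheory Filter Topology Complex

/-- The full-space measure on `[m] ⊔ [m] → ℝ` (Lebesgue, as a product). [cite: ConlonFoxZhao2014, Section 9] -/
def fullMeasure (m : ℕ) : Measure (Fin m ⊕ Fin m → ℝ) := Measure.pi fun _ => (volume : Measure ℝ)

/-- `fullMeasure m` is the `volume` of `MeasureSpace.pi` (definitional); the name is kept for readability of
the integrals below. [folklore] -/
@[simp] theorem fullMeasure_eq_volume (m : ℕ) : fullMeasure m = volume := rfl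

variable {χ : ℝ → ℝ} (hs : ContDiff ℝ (⊤ : ℕ∞) χ) (hsupp : ∀ x, 1 ≤ |x| → χ x = 0)
include hs hsupp

/-- The summands are integrable on the whole space (`|c ∏_v μ φ(η_v) dd_v^{-z}| ≤ |c| ∏_v |φ(η_v)|`,
a product of integrable functions), `R > 1`. [cite: ConlonFoxZhao2014, Section 9] -/
theorem integrable_coef_prod_full {R : ℝ} (hR : 1 < R) (dd : Fin m ⊕ Fin m → ℕ) (hdd : ∀ v, 1 ≤ dd v) (c : ℂ) :
    Integrable (fun η : Fin m ⊕ Fin m → ℝ =>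
      c * ∏ v, ((ArithmeticFunction.moebius (dd v) : ℂ) * (phiF χ (η v) * ((dd v : ℕ) : ℂ) ^ (-(zOf R (η v))))))
      (fullMeasure m) := by
  have hφi := phiF_integrable hs hsupp
  have hφc : Continuous (phiF χ) := by rw [← phiS_coe hs hsupp]; exact (phiS hs hsupp).continuous
  have hlogR : 0 < Real.log R := Real.log_pos hR
  -- dominator: `‖c‖ ∏_v ‖φ(η_v)‖`
  have hdom : Integrable (fun η : Fin m ⊕ Fin m → ℝ => ‖c‖ * ∏ v, ‖phiF χ (η v)‖) (fullMeasure m) := by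
    unfold fullMeasure
    exact (Integrable.fintype_prod (f := fun _ x => ‖phiF χ x‖) fun _ => hφi.norm).const_mul _
  have hcont : Continuous fun η : Fin m ⊕ Fin m → ℝ =>
      c * ∏ v, ((ArithmeticFunction.moebius (dd v) : ℂ) * (phiF χ (η v) * ((dd v : ℕ) : ℂ) ^ (-(zOf R (η v))))) := by
    refine continuous_const.mul (continuous_finsetProd _ fun v _ => continuous_const.mul ?_)
    refine (hφc.comp (continuous_apply v)).mul ?_
    have hd0 : ((dd v : ℕ) : ℂ) ≠ 0 := by exact_mod_cast (by have := hdd v; omega : dd v ≠ 0)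
    exact Continuous.const_cpow (((continuous_zOf R).comp (continuous_apply v)).neg) (Or.inl hd0)
  refine hdom.mono' hcont.aestronglyMeasurable (Filter.Eventually.of_forall fun η => ?_)
  rw [norm_mul, norm_prod]
  refine mul_le_mul_of_nonneg_left (prod_le_prod (fun v _ => norm_nonneg _) fun v _ => ?_) (norm_nonneg _)
  rw [norm_mul, norm_mul, norm_natCast_cpow_neg_zOf R (hdd v)]
  have hμ : ‖(ArithmeticFunction.moebius (dd v) : ℂ)‖ ≤ 1 := by
    rw [Complex.norm_intCast]; exact_mod_cast ArithmeticFunction.abs_moebius_le_one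
  have hds : (dd v : ℝ) ^ (-(1 / Real.log R)) ≤ 1 :=
    Real.rpow_le_one_of_one_le_of_nonpos (by exact_mod_cast hdd v) (by rw [neg_nonpos]; positivity)
  calc ‖(ArithmeticFunction.moebius (dd v) : ℂ)‖ * (‖phiF χ (η v)‖ * (dd v : ℝ) ^ (-(1 / Real.log R)))
      ≤ 1 * (‖phiF χ (η v)‖ * 1) := by gcongr
    _ = ‖phiF χ (η v)‖ := by ring

/-- **The expanded sum as an integral over `ℝ^{[m] ⊔ [m]}`, exactly**: for square-free tuples with prime
factors in a finite set of primes `P`,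
`∑_{dd} tupleDensity(dd) (∏_v μ(dd_v)) ∏_v χ(log dd_v/log R) = ∫ (∏_v φ(η_v)) ∏_{p∈P} E_p(z(η)) dη`.
[cite: ConlonFoxZhao2014, Section 9, equations (32)–(33), untruncated] -/
theorem sum_coef_prod_chi_eq_integral {R : ℝ} (hR : 1 < R) {P : Finset ℕ} (hP : ∀ p ∈ P, p.Prime) (W : ℕ)
    (L : Fin m → Fin t → ℤ) (b : Fin m → ℤ) :
    ∑ dd ∈ Fintype.piFinset (fun _ : Fin m ⊕ Fin m => squarefreeOf P),
        (tupleDensity W L b (fun j => dd (Sum.inl j)) (fun j => dd (Sum.inr j)) : ℂ) *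
          ((∏ v, (ArithmeticFunction.moebius (dd v) : ℂ)) * ∏ v, ((χ (Real.log (dd v) / Real.log R) : ℝ) : ℂ)) =
      ∫ η, (∏ v, phiF χ (η v)) *
        ∏ p ∈ P, eulerFactor p W L b (zL R η) (zR R η) ∂(fullMeasure m) := by
  have hdd1 : ∀ dd ∈ Fintype.piFinset (fun _ : Fin m ⊕ Fin m => squarefreeOf P), ∀ v, 1 ≤ dd v := by
    intro dd hdd v
    have h := (mem_squarefreeOf hP).1 (Fintype.mem_piFinset.1 hdd v)
    exact Nat.pos_of_ne_zero h.1.ne_zero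
  -- each `χ` factor as a full integral, and the product of integrals as an integral over the product
  have hterm : ∀ dd ∈ Fintype.piFinset (fun _ : Fin m ⊕ Fin m => squarefreeOf P),
      (tupleDensity W L b (fun j => dd (Sum.inl j)) (fun j => dd (Sum.inr j)) : ℂ) *
          ((∏ v, (ArithmeticFunction.moebius (dd v) : ℂ)) * ∏ v, ((χ (Real.log (dd v) / Real.log R) : ℝ) : ℂ)) =
        ∫ η, (tupleDensity W L b (fun j => dd (Sum.inl j)) (fun j => dd (Sum.inr j)) : ℂ) *
          ∏ v, ((ArithmeticFunction.moebius (dd v) : ℂ) * (phiF χ (η v) * ((dd v : ℕ) : ℂ) ^ (-(zOf R (η v)))))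
          ∂(fullMeasure m) := by
    intro dd hdd
    have hχ : ∏ v, ((χ (Real.log (dd v) / Real.log R) : ℝ) : ℂ) =
        ∫ η, ∏ v, phiF χ (η v) * ((dd v : ℕ) : ℂ) ^ (-(zOf R (η v))) ∂(fullMeasure m) := by
      unfold fullMeasure
      rw [integral_fintype_prod_eq_prod (f := fun v x => phiF χ x * ((dd v : ℕ) : ℂ) ^ (-(zOf R x)))]
      exact Fintype.prod_congr _ _ fun v => chi_eq_integral hs hsupp hR (hdd1 dd hdd v)
    rw [hχ, ← integral_const_mul, ← integral_const_mul]
    refine integral_congr_ae (Filter.Eventually.of_forall fun η => ?_)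
    simp only [prod_mul_distrib]
  rw [sum_congr rfl hterm, ← integral_finsetSum _ fun dd hdd =>
    integrable_coef_prod_full hs hsupp hR dd (hdd1 dd hdd) _]
  refine integral_congr_ae (Filter.Eventually.of_forall fun η => ?_)
  show ∑ dd ∈ Fintype.piFinset (fun _ : Fin m ⊕ Fin m => squarefreeOf P),
      (tupleDensity W L b (fun j => dd (Sum.inl j)) (fun j => dd (Sum.inr j)) : ℂ) *
        ∏ v, ((ArithmeticFunction.moebius (dd v) : ℂ) * (phiF χ (η v) * ((dd v : ℕ) : ℂ) ^ (-(zOf R (η v))))) =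
    (∏ v, phiF χ (η v)) * ∏ p ∈ P, eulerFactor p W L b (zL R η) (zR R η)
  rw [← tupleSum_eq_prod_eulerFactor hP]
  unfold tupleSum
  rw [mul_sum]
  refine sum_congr rfl fun dd _ => ?_
  have hz : ∀ v, sumExp (zL R η) (zR R η) v = zOf R (η v) := fun v => by rcases v with j | j <;> rfl
  simp only [hz, prod_mul_distrib]
  ring

/-- **`I_Q → I_∞` on the whole space**: dominated convergence with the integrable dominator
`B ‖∏_v φ(η_v)‖`. [cite: ConlonFoxZhao2014, Section 9] -/
theorem tendsto_integral_prod_eulerFactor_full (R : ℝ) (W : ℕ) {n : ℕ} (L : Fin m → Fin (n + 1) → ℤ)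
    (b : Fin m → ℤ) {B : ℝ}
    (hB : ∀ (Q : ℕ) (η : Fin m ⊕ Fin m → ℝ),
      ‖∏ p ∈ Q.primesBelow, eulerFactor p W L b (zL R η) (zR R η)‖ ≤ B)
    (hlim : ∀ η : Fin m ⊕ Fin m → ℝ, ∃ l : ℂ,
      Tendsto (fun Q : ℕ => ∏ p ∈ Q.primesBelow, eulerFactor p W L b (zL R η) (zR R η)) atTop (𝓝 l)) :
    Tendsto (fun Q : ℕ => ∫ η, (∏ v, phiF χ (η v)) * ∏ p ∈ Q.primesBelow, eulerFactor p W L b (zL R η) (zR R η)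
        ∂(fullMeasure m)) atTop
      (𝓝 (∫ η, (∏ v, phiF χ (η v)) * (hlim η).choose ∂(fullMeasure m))) := by
  have hφi := phiF_integrable hs hsupp
  have hφc : Continuous (phiF χ) := by rw [← phiS_coe hs hsupp]; exact (phiS hs hsupp).continuous
  have hΦc : Continuous fun η : Fin m ⊕ Fin m → ℝ => ∏ v, phiF χ (η v) :=
    continuous_finsetProd _ fun v _ => hφc.comp (continuous_apply v)
  have hΦi : Integrable (fun η : Fin m ⊕ Fin m → ℝ => ‖∏ v, phiF χ (η v)‖ * B) (fullMeasure m) := by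
    have h1 : Integrable (fun η : Fin m ⊕ Fin m → ℝ => ∏ v, phiF χ (η v)) (fullMeasure m) := by
      unfold fullMeasure; exact Integrable.fintype_prod (f := fun _ x => phiF χ x) fun _ => hφi
    exact h1.norm.mul_const B
  have hB0 : 0 ≤ B := (norm_nonneg _).trans (hB 0 0)
  refine tendsto_integral_of_dominated_convergence (fun η => ‖∏ v, phiF χ (η v)‖ * B)
    (fun Q => ?_) hΦi (fun Q => Filter.Eventually.of_forall fun η => ?_)
    (Filter.Eventually.of_forall fun η => ?_)
  · refine (hΦc.mul ?_).aestronglyMeasurable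
    exact continuous_finsetProd _ fun p hp =>
      continuous_eulerFactor_zOf R p W (Nat.mem_primesBelow.1 hp).2.pos L b
  · rw [norm_mul]
    exact mul_le_mul_of_nonneg_left (hB Q η) (norm_nonneg _)
  · exact tendsto_const_nhds.mul (hlim η).choose_spec

end Untruncated

/-! ### S7 step (vii'), the full-space main integral: regrouping the slots into pairs -/

section Regroup

open MeasureTheory

/-- **Regrouping** `ℝ^{[m] ⊔ [m]} ≃ (ℝ^m) × (ℝ^m)`: for `f : ℝ → ℝ → ℂ` with `(x, y) ↦ ∏_j f(x_j, y_j)`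
integrable on the product,
`∫ ∏_j f(η_{inl j}, η_{inr j}) dη = (∫_x ∫_y f(x, y))^m`. [folklore] -/
theorem integral_prod_pairs_eq_pow (f : ℝ → ℝ → ℂ)
    (hint : Integrable (fun p : (Fin m → ℝ) × (Fin m → ℝ) => ∏ j, f (p.1 j) (p.2 j))
      ((Measure.pi fun _ : Fin m => (volume : Measure ℝ)).prod (Measure.pi fun _ : Fin m => (volume : Measure ℝ)))) :
    ∫ η, ∏ j, f (η (Sum.inl j)) (η (Sum.inr j)) ∂(fullMeasure m) = (∫ x : ℝ, ∫ y : ℝ, f x y) ^ m := by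
  have hmp := measurePreserving_sumPiEquivProdPi (fun _ : Fin m ⊕ Fin m => (volume : Measure ℝ))
  -- transport to the product space
  have h1 : ∫ η, ∏ j, f (η (Sum.inl j)) (η (Sum.inr j)) ∂(fullMeasure m) =
      ∫ p : (Fin m → ℝ) × (Fin m → ℝ), ∏ j, f (p.1 j) (p.2 j)
        ∂((Measure.pi fun _ : Fin m => (volume : Measure ℝ)).prod (Measure.pi fun _ : Fin m => (volume : Measure ℝ))) := by
    unfold fullMeasure
    rw [← hmp.integral_comp' (g := fun p : (Fin m → ℝ) × (Fin m → ℝ) => ∏ j, f (p.1 j) (p.2 j))]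
    rfl
  rw [h1, integral_prod _ hint]
  -- inner integral: a product of one-dimensional integrals
  have h2 : ∀ x : Fin m → ℝ, ∫ y : Fin m → ℝ, ∏ j, f (x j) (y j) ∂(Measure.pi fun _ => volume) =
      ∏ j, ∫ y : ℝ, f (x j) y := fun x =>
    integral_fintype_prod_eq_prod (f := fun j y => f (x j) y)
  simp_rw [show ∀ x : Fin m → ℝ, (∫ y : Fin m → ℝ, (fun p : (Fin m → ℝ) × (Fin m → ℝ) => ∏ j, f (p.1 j) (p.2 j)) (x, y)
      ∂(Measure.pi fun _ => volume)) = ∏ j, ∫ y : ℝ, f (x j) y from h2]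
  rw [integral_fintype_prod_eq_prod (f := fun _ x => ∫ y : ℝ, f x y), prod_const, card_univ, Fintype.card_fin]

end Regroup

/-! ### S7 step (vii'), the full-space main integral equals `(c_χ/log R)^m` -/

section MainIntegral

open MeasureTheory Complex

variable {χ : ℝ → ℝ} (hs : ContDiff ℝ (⊤ : ℕ∞) χ) (hsupp : ∀ x, 1 ≤ |x| → χ x = 0)

/-- The weight `g(x) = |φ(x)| (1 + 2π|x|)`. [cite: ConlonFoxZhao2014, Section 9] -/
def phiWeight (χ : ℝ → ℝ) (x : ℝ) : ℝ := ‖phiF χ x‖ * (1 + 2 * Real.pi * |x|)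

/-- The pair kernel `φ(x)φ(y) z(x)z(y)/(z(x)+z(y))`. [cite: ConlonFoxZhao2014, Section 9] -/
def pairF (χ : ℝ → ℝ) (R x y : ℝ) : ℂ := phiF χ x * phiF χ y * (zOf R x * zOf R y / (zOf R x + zOf R y))

include hs hsupp in
/-- `g` is integrable (Schwartz decay of `φ` with exponent `3`). [cite: ConlonFoxZhao2014, Section 9] -/
theorem integrable_phiWeight : Integrable (phiWeight χ) := by
  obtain ⟨C, hC0, hφ⟩ := norm_phiF_le hs hsupp 3
  have hint : Integrable fun x : ℝ => (2 * Real.pi * C) * (1 + ‖x‖) ^ (-(2 : ℝ)) :=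
    (integrable_one_add_norm (by simp)).const_mul _
  have hφc : Continuous (phiF χ) := by rw [← phiS_coe hs hsupp]; exact (phiS hs hsupp).continuous
  have hcont : Continuous (phiWeight χ) := by unfold phiWeight; fun_prop
  refine hint.mono' hcont.aestronglyMeasurable (Filter.Eventually.of_forall fun x => ?_)
  rw [Real.norm_eq_abs, abs_of_nonneg (by unfold phiWeight; positivity)]
  unfold phiWeight
  have hx : 0 < 1 + |x| := by positivity
  have h1 : 1 + 2 * Real.pi * |x| ≤ 2 * Real.pi * (1 + |x|) := by nlinarith [Real.pi_gt_three, abs_nonneg x]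
  calc ‖phiF χ x‖ * (1 + 2 * Real.pi * |x|) ≤ (C * ((1 + |x|) ^ 3)⁻¹) * (2 * Real.pi * (1 + |x|)) :=
        mul_le_mul (hφ x) h1 (by positivity) (by positivity)
    _ = (2 * Real.pi * C) * (1 + ‖x‖) ^ (-(2 : ℝ)) := by
        rw [Real.norm_eq_abs, Real.rpow_neg hx.le, show ((1 + |x|) ^ (2 : ℝ)) = (1 + |x|) ^ (2 : ℕ) by norm_cast]
        field_simp

/-- `|z(x) z(y)/(z(x) + z(y))| ≤ (2 log R)⁻¹ (1 + 2π|x|)(1 + 2π|y|)` (`Re(z+z') = 2/log R`).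
[cite: ConlonFoxZhao2014, Section 9] -/
theorem norm_zOf_mul_div_le {R : ℝ} (hR : 1 < R) (x y : ℝ) :
    ‖zOf R x * zOf R y / (zOf R x + zOf R y)‖ ≤ (2 * Real.log R)⁻¹ * ((1 + 2 * Real.pi * |x|) * (1 + 2 * Real.pi * |y|)) := by
  have hlogR : 0 < Real.log R := Real.log_pos hR
  have hsum : 2 / Real.log R ≤ ‖zOf R x + zOf R y‖ := by
    have h := Complex.abs_re_le_norm (zOf R x + zOf R y)
    rw [Complex.add_re, zOf_re, zOf_re] at h
    rw [show (2 : ℝ) / Real.log R = |1 / Real.log R + 1 / Real.log R| by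
      rw [abs_of_pos (by positivity)]; ring]
    exact h
  have hpos : 0 < ‖zOf R x + zOf R y‖ := lt_of_lt_of_le (by positivity) hsum
  rw [norm_div, norm_mul, div_le_iff₀ hpos]
  have h1 := norm_zOf_le hR x
  have h2 := norm_zOf_le hR y
  calc ‖zOf R x‖ * ‖zOf R y‖ ≤ ((1 + 2 * Real.pi * |x|) / Real.log R) * ((1 + 2 * Real.pi * |y|) / Real.log R) :=
        mul_le_mul h1 h2 (norm_nonneg _) (by positivity)
    _ = (2 * Real.log R)⁻¹ * ((1 + 2 * Real.pi * |x|) * (1 + 2 * Real.pi * |y|)) * (2 / Real.log R) := by field_simp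
    _ ≤ (2 * Real.log R)⁻¹ * ((1 + 2 * Real.pi * |x|) * (1 + 2 * Real.pi * |y|)) * ‖zOf R x + zOf R y‖ := by gcongr

/-- `‖pairF(x,y)‖ ≤ (2 log R)⁻¹ g(x) g(y)`. [cite: ConlonFoxZhao2014, Section 9] -/
theorem norm_pairF_le {R : ℝ} (hR : 1 < R) (x y : ℝ) :
    ‖pairF χ R x y‖ ≤ (2 * Real.log R)⁻¹ * (phiWeight χ x * phiWeight χ y) := by
  unfold pairF phiWeight
  rw [norm_mul, norm_mul]
  calc ‖phiF χ x‖ * ‖phiF χ y‖ * ‖zOf R x * zOf R y / (zOf R x + zOf R y)‖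
      ≤ ‖phiF χ x‖ * ‖phiF χ y‖ * ((2 * Real.log R)⁻¹ * ((1 + 2 * Real.pi * |x|) * (1 + 2 * Real.pi * |y|))) := by
        gcongr; exact norm_zOf_mul_div_le hR x y
    _ = (2 * Real.log R)⁻¹ * (‖phiF χ x‖ * (1 + 2 * Real.pi * |x|) * (‖phiF χ y‖ * (1 + 2 * Real.pi * |y|))) := by ring

/-- `Φ(η) · mainZ(η) = ∏_j pairF(η_{inl j}, η_{inr j})`. [cite: ConlonFoxZhao2014, Section 9] -/
theorem prod_phiF_mul_mainZ (R : ℝ) (η : Fin m ⊕ Fin m → ℝ) :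
    (∏ v, phiF χ (η v)) * mainZ R η = ∏ j, pairF χ R (η (Sum.inl j)) (η (Sum.inr j)) := by
  unfold mainZ pairF zL zR
  rw [Fintype.prod_sum_type, ← prod_mul_distrib, ← prod_mul_distrib]

/-- `pairF` is continuous in both variables jointly (`R > 1`). [cite: ConlonFoxZhao2014, Section 9] -/
theorem continuous_pairF (hs : ContDiff ℝ (⊤ : ℕ∞) χ) (hsupp : ∀ x, 1 ≤ |x| → χ x = 0) {R : ℝ} (hR : 1 < R) :
    Continuous fun p : ℝ × ℝ => pairF χ R p.1 p.2 := by
  have hφc : Continuous (phiF χ) := by rw [← phiS_coe hs hsupp]; exact (phiS hs hsupp).continuous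
  have hz := continuous_zOf R
  unfold pairF
  refine ((hφc.comp continuous_fst).mul (hφc.comp continuous_snd)).mul ?_
  exact ((hz.comp continuous_fst).mul (hz.comp continuous_snd)).div ((hz.comp continuous_fst).add (hz.comp continuous_snd))
    fun p => (zOf_ne_zero hR p.1 p.2).2

/-- `z(x) z(y)/(z(x)+z(y)) = (log R)⁻¹ · a(x) a(y)/(a(x)+a(y))` (`z = a/log R`). [cite: ConlonFoxZhao2014, Section 9] -/
theorem zOf_mul_div_eq {R : ℝ} (hR : 1 < R) (x y : ℝ) :
    zOf R x * zOf R y / (zOf R x + zOf R y) = (Real.log R : ℂ)⁻¹ * (aF x * aF y / (aF x + aF y)) := by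
  have hlogR : 0 < Real.log R := Real.log_pos hR
  have hL : (Real.log R : ℂ) ≠ 0 := by exact_mod_cast hlogR.ne'
  have ha : ∀ t : ℝ, zOf R t = aF t / (Real.log R : ℂ) := fun t => rfl
  have hne : aF x + aF y ≠ 0 := by
    intro h; have := congrArg Complex.re h; simp [aF] at this
  rw [ha, ha, ← add_div]
  field_simp

/-- The kernel of `integral_integral_phiF_kernel` is `a(x)a(y)/(a(x)+a(y))`. [cite: ConlonFoxZhao2014, Section 9] -/
theorem kernel_eq_aF (x y : ℝ) :
    (1 - 2 * Real.pi * x * I) * (1 - 2 * Real.pi * y * I) / (2 - 2 * Real.pi * (x + y) * I) =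
      aF x * aF y / (aF x + aF y) := by
  have h : aF x + aF y = 2 - 2 * Real.pi * (x + y) * I := by simp only [aF]; ring
  rw [h]; rfl

include hs hsupp in
/-- **The inner double integral**: `∫_x ∫_y pairF(x, y) = c_χ / log R` (CFZ (38), via
`integral_integral_phiF_kernel` and `z z'/(z+z') = (log R)⁻¹ a a'/(a+a')`).
[cite: ConlonFoxZhao2014, Section 9, equation (38)] -/
theorem integral_integral_pairF {R : ℝ} (hR : 1 < R) :
    ∫ x : ℝ, ∫ y : ℝ, pairF χ R x y =
      (Real.log R : ℂ)⁻¹ * ((∫ x in Set.Ioi (0 : ℝ), (deriv χ x) ^ 2 : ℝ) : ℂ) := by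
  have hkernel : ∀ x y : ℝ, pairF χ R x y = (Real.log R : ℂ)⁻¹ *
      (phiF χ x * phiF χ y * ((1 - 2 * Real.pi * x * I) * (1 - 2 * Real.pi * y * I) / (2 - 2 * Real.pi * (x + y) * I))) := by
    intro x y
    unfold pairF
    rw [zOf_mul_div_eq hR, kernel_eq_aF]
    ring
  simp_rw [hkernel]
  rw [integral_congr_ae (Filter.Eventually.of_forall fun x => integral_const_mul _ _), integral_const_mul,
    integral_integral_phiF_kernel hs hsupp]

/-- The pointwise domination `‖∏_j pairF(x_j,y_j)‖ ≤ (2 log R)^{-m} ∏ g(x_j) ∏ g(y_j)`.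
[cite: ConlonFoxZhao2014, Section 9] -/
theorem norm_prod_pairF_le {R : ℝ} (hR : 1 < R) (p : (Fin m → ℝ) × (Fin m → ℝ)) :
    ‖∏ j, pairF χ R (p.1 j) (p.2 j)‖ ≤
      ((2 * Real.log R)⁻¹) ^ m * ((∏ j, phiWeight χ (p.1 j)) * ∏ j, phiWeight χ (p.2 j)) := by
  have hb : ∀ j, ‖pairF χ R (p.1 j) (p.2 j)‖ ≤ (2 * Real.log R)⁻¹ * (phiWeight χ (p.1 j) * phiWeight χ (p.2 j)) :=
    fun j => norm_pairF_le hR _ _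
  calc ‖∏ j, pairF χ R (p.1 j) (p.2 j)‖ = ∏ j, ‖pairF χ R (p.1 j) (p.2 j)‖ := norm_prod _ _
    _ ≤ ∏ j, ((2 * Real.log R)⁻¹ * (phiWeight χ (p.1 j) * phiWeight χ (p.2 j))) :=
        prod_le_prod (fun j _ => norm_nonneg _) fun j _ => hb j
    _ = ((2 * Real.log R)⁻¹) ^ m * ((∏ j, phiWeight χ (p.1 j)) * ∏ j, phiWeight χ (p.2 j)) := by
        rw [prod_mul_distrib, prod_mul_distrib, prod_const, card_univ, Fintype.card_fin]

/-- Each factor `p ↦ pairF(x_j, y_j)` is continuous on `ℝ^m × ℝ^m` (built from the composite directly, which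
avoids an expensive definitional unfolding of `phiF` during unification). [cite: ConlonFoxZhao2014, Section 9] -/
theorem continuous_pairF_apply (hs : ContDiff ℝ (⊤ : ℕ∞) χ) (hsupp : ∀ x, 1 ≤ |x| → χ x = 0)
    {R : ℝ} (hR : 1 < R) (j : Fin m) :
    Continuous fun p : (Fin m → ℝ) × (Fin m → ℝ) => pairF χ R (p.1 j) (p.2 j) := by
  have hφc : Continuous (phiF χ) := by rw [← phiS_coe hs hsupp]; exact (phiS hs hsupp).continuous
  have hz := continuous_zOf R
  have h1 : Continuous fun p : (Fin m → ℝ) × (Fin m → ℝ) => p.1 j := (continuous_apply j).comp continuous_fst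
  have h2 : Continuous fun p : (Fin m → ℝ) × (Fin m → ℝ) => p.2 j := (continuous_apply j).comp continuous_snd
  unfold pairF
  exact ((hφc.comp h1).mul (hφc.comp h2)).mul (((hz.comp h1).mul (hz.comp h2)).div ((hz.comp h1).add (hz.comp h2))
    fun p => (zOf_ne_zero hR _ _).2)

/-- `∏_j pairF(x_j, y_j)` is a.e.-strongly measurable (continuous). [cite: ConlonFoxZhao2014, Section 9] -/
theorem aestronglyMeasurable_prod_pairF (hs : ContDiff ℝ (⊤ : ℕ∞) χ) (hsupp : ∀ x, 1 ≤ |x| → χ x = 0)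
    {R : ℝ} (hR : 1 < R) (μ : Measure ((Fin m → ℝ) × (Fin m → ℝ))) :
    AEStronglyMeasurable (fun p : (Fin m → ℝ) × (Fin m → ℝ) => ∏ j, pairF χ R (p.1 j) (p.2 j)) μ := by
  have hc : Continuous fun p : (Fin m → ℝ) × (Fin m → ℝ) => ∏ j, pairF χ R (p.1 j) (p.2 j) :=
    continuous_finsetProd _ fun j _ => continuous_pairF_apply hs hsupp hR j
  exact hc.aestronglyMeasurable

/-- Generic: integrability of `∏_j f(x_j, y_j)` on `ℝ^m × ℝ^m` from a product domination. [folklore] -/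
theorem integrable_prod_of_dominated (f : ℝ → ℝ → ℂ) (g : ℝ → ℝ) (hg : Integrable g) (C : ℝ)
    (hmeas : AEStronglyMeasurable (fun p : (Fin m → ℝ) × (Fin m → ℝ) => ∏ j, f (p.1 j) (p.2 j))
      ((Measure.pi fun _ : Fin m => (volume : Measure ℝ)).prod (Measure.pi fun _ : Fin m => (volume : Measure ℝ))))
    (hb : ∀ p : (Fin m → ℝ) × (Fin m → ℝ), ‖∏ j, f (p.1 j) (p.2 j)‖ ≤ C * ((∏ j, g (p.1 j)) * ∏ j, g (p.2 j))) :
    Integrable (fun p : (Fin m → ℝ) × (Fin m → ℝ) => ∏ j, f (p.1 j) (p.2 j))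
      ((Measure.pi fun _ : Fin m => (volume : Measure ℝ)).prod (Measure.pi fun _ : Fin m => (volume : Measure ℝ))) := by
  have hG : Integrable (fun x : Fin m → ℝ => ∏ j, g (x j)) (Measure.pi fun _ : Fin m => (volume : Measure ℝ)) :=
    Integrable.fintype_prod (f := fun _ => g) fun _ => hg
  have hdom : Integrable (fun p : (Fin m → ℝ) × (Fin m → ℝ) => C * ((∏ j, g (p.1 j)) * ∏ j, g (p.2 j)))
      ((Measure.pi fun _ : Fin m => (volume : Measure ℝ)).prod (Measure.pi fun _ : Fin m => (volume : Measure ℝ))) :=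
    (hG.mul_prod hG).const_mul C
  exact hdom.mono' hmeas (ae_of_all _ hb)

include hs hsupp in
/-- `∏_j pairF(x_j, y_j)` is integrable on `ℝ^m × ℝ^m` (dominated by `(2 log R)^{-m} ∏ g(x_j) ∏ g(y_j)`).
[cite: ConlonFoxZhao2014, Section 9] -/
theorem integrable_prod_pairF {R : ℝ} (hR : 1 < R) :
    Integrable (fun p : (Fin m → ℝ) × (Fin m → ℝ) => ∏ j, pairF χ R (p.1 j) (p.2 j))
      ((Measure.pi fun _ : Fin m => (volume : Measure ℝ)).prod (Measure.pi fun _ : Fin m => (volume : Measure ℝ))) :=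
  integrable_prod_of_dominated (pairF χ R) (phiWeight χ) (integrable_phiWeight hs hsupp) _
    (aestronglyMeasurable_prod_pairF hs hsupp hR _) (norm_prod_pairF_le hR)

include hs hsupp in
/-- **The full-space main integral**: `∫ Φ · mainZ dη = (c_χ/log R)^m`.
[cite: ConlonFoxZhao2014, Section 9, equations (37)–(38)] -/
theorem integral_phiF_mainZ {R : ℝ} (hR : 1 < R) :
    ∫ η, (∏ v, phiF χ (η v)) * mainZ R η ∂(fullMeasure m) =
      ((Real.log R : ℂ)⁻¹ * ((∫ x in Set.Ioi (0 : ℝ), (deriv χ x) ^ 2 : ℝ) : ℂ)) ^ m := by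
  have h1 : ∫ η, (∏ v, phiF χ (η v)) * mainZ R η ∂(fullMeasure m) =
      ∫ η, ∏ j, pairF χ R (η (Sum.inl j)) (η (Sum.inr j)) ∂(fullMeasure m) :=
    integral_congr_ae (Filter.Eventually.of_forall fun η => prod_phiF_mul_mainZ R η)
  rw [h1, integral_prod_pairs_eq_pow (pairF χ R) (integrable_prod_pairF hs hsupp hR), integral_integral_pairF hs hsupp hR]

end MainIntegral

end Literature.NumberTheory.Sieve.CFZ
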